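import Literature.NumberTheory.LFunctions.MoebiusWalshTypeIEstimate
import Literature.NumberTheory.LFunctions.MoebiusWalshBoxCriterion
import Literature.NumberTheory.LFunctions.MoebiusWalshCircuitsACdProofs
import Literature.Computability.Complexity.MoebiusBoundedDepthWalshProofs
import Mathlib.Analysis.SpecialFunctions.Pow.Asymptotics
import HarnessLib

/-!
# Bourgain 2013, Theorem 1 for `μ` from a type-II box bound (the assembly of §§2–3) — proved

Topic `Literature/NumberTheory/LFunctions`, a proofs companion of `MoebiusWalshCircuits.lean`
(named facts `bourgain_moebius_walsh_uniform`, `bourgain_liouville_walsh_uniform`: J. Bourgain,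
*Möbius–Walsh correlation bounds and an estimate of Mauduit and Rivat*, J. Anal. Math. **119**
(2013) 147–163 = arXiv:1109.2784 [Bourgain2013MoebiusWalsh], Theorem 1). Everything in this file
is PROVED (theorems only; no definition, no named fact, nothing discharged).

## What is proved

`bourgain_moebius_walsh_uniform_of_typeII : (∃ c > 0, ∃ C ≥ 0, TypeII c C) → bourgain_moebius_walsh_uniform`

where `TypeII c C` is the displayed (inline) hypothesis: for the short side `M = 2^i ≤ N = 2^j` of a
dyadic box, a digit set `T ⊆ [0, i+j+2)`, `1`-bounded coefficients `α, β`, a guard `1 ≤ g₀ ≤ ρ`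
with `Cρ ≤ i`, and a window origin `K` which is ADMISSIBLE — `K = 0 ∨ i - ρ ≤ K` (Bourgain: "either
`K = 0` or `μ - ρ ≤ K`"), and either `K + w + 1 ≤ j` (a middle window: the guard-digit count needs
`2^{K+ρ+2} ≤ N 2^{-g₀}`) or `j + 2 ≤ K + w ∧ K + ρ ≤ j` (a top window: it reaches the top digit
`i + j + 2`, so no truncation from above is needed, and the lags `ℓ2^K < 2^{ρ+K}` stay `≤ N`),
`w = ρ + g₀ + 1` —

  `|boxSum T i j α β| ≤ 2^{i+j} (i+j+2)^C (2^{-c g₀} + 2^{Cρ - c i} + 2^{Cρ - c |T ∩ [K, K+i+w)|})`.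

This is Bourgain's type-II estimate (2.29)/(2.31), `(2.1) < X(L^{-cε} + L²M^{-c} + L^C 2^{-c|S'|})`
with `L = 2^ρ`, `ερ = g₀`, `S' = T ∩ [K, K+μ+ρ']`, the polylogarithmic losses (`(K+2)`, divisor
sums, `(log X)^C`) collected in `(i+j+2)^C` and the terms `1/L`, `LN^{-c}`, `L³M^{-c}` absorbed
(`c ≤ 1`, `C ≥ 3`); degenerate parameter ranges (`ρ ≲ log(i+j)`, sparse windows) make the right side
`≥ 2^{i+j}` and are vacuous. It is the one statement of the paper not yet in the tree; landing it (in
this or an equivalent form, for some `c, C`) discharges `bourgain_moebius_walsh_uniform` by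
`bourgain_moebius_walsh_uniform_of_typeII`, and the Liouville twin the same way once the
`λ`-analogue of the Vaughan reduction is available.

## The assembly (Bourgain, §3, "Type-I sums and conclusion", made quantitative)

All parameters are read off `n` through `q = ⌊n^{1/8}⌋` (triple integer square root) and
`s = ⌊√n⌋`; `schedule_eventually` proves once and for all the finitely many numerical inequalities
between them for large `n` (each compares two different powers of `n^{1/8}`, or a power and a
logarithm; `linarith` on division-free forms).

* `A = ∅`: Green's four-term identity `μ̂(∅) + μ̂({0}) + μ̂({1}) + μ̂({0,1}) = 0` (tree) and Green's
  Proposition 1 (tree, proved: `Literature.Computability.Complexity.green_moebius_fourierWalsh_holds`)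
  for the three sets of weight `≤ 2` (`green_empty`).
* `1 ≤ |A| ≤ s/q ≍ n^{3/8}`: Green's Proposition 1 gives `K_G n e^{-c_G q} 2ⁿ < 2^{n-n^{1/10}}`
  (`green_small`; the paper's range `|A| ≤ λ^{1/2}/H`).
* `|A| > s/q`: the tree's Vaughan reduction `abs_walshSum_moebius_le_boxes` with `u = 2^{⌊n/8⌋}`,
  divisor cut `B = 2^q`, through the criterion `abs_walshSum_moebius_le_of_boxBounds`
  (`MoebiusWalshBoxCriterion.lean`) with `s₀ = 3q`; every large box `D_i × D_j`
  (`i + j < n ≤ i + j + 3q`) is bounded by `2^{i+j-2q}` (type I) resp. `2^{i+j-5q}` (type II):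
  - digit sets: `T ∈ {S, S ∪ {n}}` is cut to `T' = T ∩ [0, i+j+2)` (`boxSum_eq_boxSum_filter`), which
    keeps `≥ M₀ = s/q - 1 - 3q ≍ n^{3/8}` digits (`M₀_le_card_cut`);
  - TYPE-II boxes (`i, j ≥ ⌊n/8⌋`, short side first by `boxSum_comm`): a covering family of `≤ 24`
    admissible windows (`exists_dense_window`: origins `ti` and `j - ρ`) has a member carrying
    `≥ |T'|/24` digits, and the hypothesis with `g₀ = ρ = ⌈(C+7)q/c⌉` gives the three savings, each
    `≤ 2^{-(C+7)q}` (`three_terms_le`, `typeII_box`);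
  - TYPE-I boxes (`i ≤ 2⌊n/8⌋`, coefficient `|μ_u ∗ μ_u| ≤ τ` removed by Cauchy–Schwarz,
    `abs_boxSum_typeI_le`): the trichotomy of `typeI_box` — `i ≤ c₂|T'|/2`: the crude bound of
    `MoebiusWalshTypeIEstimate` (`typeI_crude_regime`, saving `2^i (n+2) 2^{-c₂|T'|}`); else, if the
    top `2i+2` digits carry `θ ≤ c₂|T'|/(4(1 + log₂ 2Λ))` elements: the refined bound
    (`typeI_refined_regime`, saving `(2Λ)^θ 2^{-c₂(|T'|-θ)}`, no factor `2^i`); else the top block is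
    covered by the middle window at `j - i` and the top window at `j - ρ`
    (`card_top_le_two_windows`), one of which is dense, and the hypothesis bounds
    `∑_a |∑_b w_{T'}(ab)|` (a box sum with the signs `ε_a`, `sum_abs_eq_boxSum_sign`) by `2^{i+j-5q}`;
  - boxes with `a > u²` (type I) or `a ≤ u`, `b ≤ u` (type II) vanish identically;
  - `final_numeric`: `2u + n²(E_I + …) + B n²(E_II + …) + 2ⁿ(n+1)⁴/B ≤ 6(n+1)⁴2ⁿ/2^q < 2^{n-n^{1/10}}`.

## References

* J. Bourgain, *Möbius–Walsh correlation bounds and an estimate of Mauduit and Rivat*, J. Anal.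
  Math. 119 (2013) 147–163; arXiv:1109.2784: Theorem 1, §2 (2.29)–(2.35), §3 (3.1)–(3.10).
  [Bourgain2013MoebiusWalsh]
* B. Green, *On (not) computing the Möbius function using bounded depth circuits*, Combin. Probab.
  Comput. 21 (2012), Proposition 1 (tree, proved) and §2 (the constant coefficient). [Green2012]
-/

noncomputable section

open Finset Real Filter
open scoped ArithmeticFunction.Moebius

namespace Literature.NumberTheory.LFunctions.MoebiusWalsh

/-! ### Two generic eventual inequalities -/

/-- For `a < b` and any `C`: `C x^a ≤ x^b` for all large real `x`. [folklore] -/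
theorem eventually_const_mul_rpow_le_rpow {a b : ℝ} (hab : a < b) (C : ℝ) :
    ∀ᶠ x : ℝ in atTop, C * x ^ a ≤ x ^ b := by
  filter_upwards [(tendsto_rpow_atTop (sub_pos.2 hab)).eventually_ge_atTop C,
    eventually_gt_atTop 0] with x hx hx0
  calc C * x ^ a ≤ x ^ (b - a) * x ^ a := by
        gcongr
    _ = x ^ b := by rw [← Real.rpow_add hx0]; ring_nf

/-- For `0 < a` and any `C`: `C log x ≤ x^a` for all large real `x`. [folklore] -/
theorem eventually_const_mul_log_le_rpow {a : ℝ} (ha : 0 < a) (C : ℝ) :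
    ∀ᶠ x : ℝ in atTop, C * Real.log x ≤ x ^ a := by
  have h := (isLittleO_log_rpow_atTop ha).def (c := 1 / (|C| + 1)) (by positivity)
  filter_upwards [h, eventually_gt_atTop 0] with x hx hx0
  rw [Real.norm_eq_abs, Real.norm_eq_abs, abs_of_nonneg (Real.rpow_nonneg hx0.le a)] at hx
  have h1 : C * Real.log x ≤ |C| * |Real.log x| := by
    rw [← abs_mul]; exact le_abs_self _
  refine h1.trans ?_
  calc |C| * |Real.log x| ≤ |C| * (1 / (|C| + 1) * x ^ a) := by gcongr
    _ = (|C| / (|C| + 1)) * x ^ a := by ring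
    _ ≤ 1 * x ^ a := by
        refine mul_le_mul_of_nonneg_right ?_ (Real.rpow_nonneg hx0.le a)
        rw [div_le_one (by positivity)]; linarith
    _ = x ^ a := one_mul _

/-- Transfer of an eventual property of reals to natural numbers: Mathlib's
`Filter.Eventually.natCast_atTop` (kept as a deprecated alias, dedup-01063). [folklore] -/
@[deprecated (since := "2026-08-16")]
alias eventually_natCast := Filter.Eventually.natCast_atTop

/-! ### The dyadic-root schedule `q = ⌊n^{1/8}⌋`, `s = ⌊n^{1/2}⌋`, `r = ⌊s^{1/2}⌋` -/

/-- `⌊√m⌋ ≤ m^{1/2}` in `ℝ`. [folklore] -/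
theorem natSqrt_le_rpow_half (m : ℕ) : ((Nat.sqrt m : ℕ) : ℝ) ≤ (m : ℝ) ^ ((1 : ℝ) / 2) := by
  have h : ((Nat.sqrt m : ℕ) : ℝ) ^ (2 : ℕ) ≤ (m : ℝ) := by exact_mod_cast Nat.sqrt_le' m
  calc ((Nat.sqrt m : ℕ) : ℝ) = ((((Nat.sqrt m : ℕ) : ℝ) ^ (2 : ℕ)) ^ ((1 : ℝ) / 2)) := by
        rw [← Real.rpow_natCast, ← Real.rpow_mul (Nat.cast_nonneg _)]; norm_num
    _ ≤ (m : ℝ) ^ ((1 : ℝ) / 2) := Real.rpow_le_rpow (by positivity) h (by norm_num)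

/-- `m^{1/2} < ⌊√m⌋ + 1` in `ℝ`. [folklore] -/
theorem rpow_half_lt_natSqrt_add_one (m : ℕ) : (m : ℝ) ^ ((1 : ℝ) / 2) < (Nat.sqrt m : ℕ) + 1 := by
  have h : (m : ℝ) < (((Nat.sqrt m : ℕ) : ℝ) + 1) ^ (2 : ℕ) := by exact_mod_cast Nat.lt_succ_sqrt' m
  calc (m : ℝ) ^ ((1 : ℝ) / 2) < ((((Nat.sqrt m : ℕ) : ℝ) + 1) ^ (2 : ℕ)) ^ ((1 : ℝ) / 2) :=
        Real.rpow_lt_rpow (Nat.cast_nonneg _) h (by norm_num)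
    _ = (Nat.sqrt m : ℕ) + 1 := by
        rw [← Real.rpow_natCast, ← Real.rpow_mul (by positivity)]; norm_num

/-- `⌊√m⌋ + 1 > m^{1/2}` gives `⌊√m⌋ ≥ m^{1/2} - 1`. [folklore] -/
theorem rpow_half_sub_one_le_natSqrt (m : ℕ) : (m : ℝ) ^ ((1 : ℝ) / 2) - 1 ≤ (Nat.sqrt m : ℕ) := by
  have := rpow_half_lt_natSqrt_add_one m; linarith

/-- The triple square root `q = ⌊⌊⌊√n⌋^{1/2}⌋^{1/2}⌋` satisfies `q^8 ≤ n < (q+1)^8`. [folklore] -/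
theorem tripleSqrt_pow_eight_le (n : ℕ) :
    (Nat.sqrt (Nat.sqrt (Nat.sqrt n))) ^ 8 ≤ n ∧ n < (Nat.sqrt (Nat.sqrt (Nat.sqrt n)) + 1) ^ 8 := by
  set s := Nat.sqrt n with hs
  set r := Nat.sqrt s with hr
  set q := Nat.sqrt r with hq
  have h1 : q ^ 2 ≤ r := Nat.sqrt_le' r
  have h2 : r ^ 2 ≤ s := Nat.sqrt_le' s
  have h3 : s ^ 2 ≤ n := Nat.sqrt_le' n
  have h4 : n < (s + 1) ^ 2 := Nat.lt_succ_sqrt' n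
  have h5 : s < (r + 1) ^ 2 := Nat.lt_succ_sqrt' s
  have h6 : r < (q + 1) ^ 2 := Nat.lt_succ_sqrt' r
  constructor
  · calc q ^ 8 = ((q ^ 2) ^ 2) ^ 2 := by ring
      _ ≤ (r ^ 2) ^ 2 := Nat.pow_le_pow_left (Nat.pow_le_pow_left h1 2) 2
      _ ≤ s ^ 2 := Nat.pow_le_pow_left h2 2
      _ ≤ n := h3
  · have h5' : s + 1 ≤ (r + 1) ^ 2 := h5
    have h6' : r + 1 ≤ (q + 1) ^ 2 := h6
    calc n < (s + 1) ^ 2 := h4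
      _ ≤ ((r + 1) ^ 2) ^ 2 := Nat.pow_le_pow_left h5' 2
      _ ≤ (((q + 1) ^ 2) ^ 2) ^ 2 := Nat.pow_le_pow_left (Nat.pow_le_pow_left h6' 2) 2
      _ = (q + 1) ^ 8 := by ring

/-- `q ≤ n^{1/8} < q + 1` for the triple square root `q`. [folklore] -/
theorem tripleSqrt_le_rpow (n : ℕ) :
    ((Nat.sqrt (Nat.sqrt (Nat.sqrt n)) : ℕ) : ℝ) ≤ (n : ℝ) ^ ((1 : ℝ) / 8) ∧
      (n : ℝ) ^ ((1 : ℝ) / 8) < (Nat.sqrt (Nat.sqrt (Nat.sqrt n)) : ℕ) + 1 := by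
  obtain ⟨h1, h2⟩ := tripleSqrt_pow_eight_le n
  set q := Nat.sqrt (Nat.sqrt (Nat.sqrt n)) with hq
  have h1' : ((q : ℝ)) ^ (8 : ℕ) ≤ (n : ℝ) := by exact_mod_cast h1
  have h2' : (n : ℝ) < ((q : ℝ) + 1) ^ (8 : ℕ) := by exact_mod_cast h2
  constructor
  · calc (q : ℝ) = (((q : ℝ) ^ (8 : ℕ)) ^ ((1 : ℝ) / 8)) := by
          rw [← Real.rpow_natCast, ← Real.rpow_mul (Nat.cast_nonneg _)]; norm_num
      _ ≤ (n : ℝ) ^ ((1 : ℝ) / 8) := Real.rpow_le_rpow (by positivity) h1' (by norm_num)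
  · calc (n : ℝ) ^ ((1 : ℝ) / 8) < (((q : ℝ) + 1) ^ (8 : ℕ)) ^ ((1 : ℝ) / 8) :=
          Real.rpow_lt_rpow (Nat.cast_nonneg _) h2' (by norm_num)
      _ = (q : ℝ) + 1 := by
          rw [← Real.rpow_natCast, ← Real.rpow_mul (by positivity)]; norm_num

/-- `⌊√⌊√n⌋⌋ + 1 > n^{1/4}`. [folklore] -/
theorem rpow_quarter_lt_doubleSqrt_add_one (n : ℕ) :
    (n : ℝ) ^ ((1 : ℝ) / 4) < (Nat.sqrt (Nat.sqrt n) : ℕ) + 1 := by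
  set s := Nat.sqrt n with hs
  set r := Nat.sqrt s with hr
  have h4 : n < (s + 1) ^ 2 := Nat.lt_succ_sqrt' n
  have h5 : s + 1 ≤ (r + 1) ^ 2 := Nat.lt_succ_sqrt' s
  have h : n < (r + 1) ^ 4 := by
    calc n < (s + 1) ^ 2 := h4
      _ ≤ ((r + 1) ^ 2) ^ 2 := Nat.pow_le_pow_left h5 2
      _ = (r + 1) ^ 4 := by ring
  have h' : (n : ℝ) < ((r : ℝ) + 1) ^ (4 : ℕ) := by exact_mod_cast h
  calc (n : ℝ) ^ ((1 : ℝ) / 4) < (((r : ℝ) + 1) ^ (4 : ℕ)) ^ ((1 : ℝ) / 4) :=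
        Real.rpow_lt_rpow (Nat.cast_nonneg _) h' (by norm_num)
    _ = (r : ℝ) + 1 := by
        rw [← Real.rpow_natCast, ← Real.rpow_mul (by positivity)]; norm_num

/-- `⌊√⌊√n⌋⌋ ≤ n^{1/4}`. [folklore] -/
theorem doubleSqrt_le_rpow_quarter (n : ℕ) :
    ((Nat.sqrt (Nat.sqrt n) : ℕ) : ℝ) ≤ (n : ℝ) ^ ((1 : ℝ) / 4) := by
  set s := Nat.sqrt n with hs
  set r := Nat.sqrt s with hr
  have h : r ^ 4 ≤ n := by
    calc r ^ 4 = (r ^ 2) ^ 2 := by ring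
      _ ≤ s ^ 2 := Nat.pow_le_pow_left (Nat.sqrt_le' s) 2
      _ ≤ n := Nat.sqrt_le' n
  have h' : ((r : ℝ)) ^ (4 : ℕ) ≤ (n : ℝ) := by exact_mod_cast h
  calc (r : ℝ) = (((r : ℝ) ^ (4 : ℕ)) ^ ((1 : ℝ) / 4)) := by
        rw [← Real.rpow_natCast, ← Real.rpow_mul (Nat.cast_nonneg _)]; norm_num
    _ ≤ (n : ℝ) ^ ((1 : ℝ) / 4) := Real.rpow_le_rpow (by positivity) h' (by norm_num)

/-- **The scale `u₀ = ⌊√n⌋ · ⌊√⌊√n⌋⌋ ≍ n^{3/4}`**: `n^{3/4} - n^{1/2} - n^{1/4} ≤ u₀ ≤ n^{3/4}`. [folklore] -/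
theorem sched_u₀_bounds (n : ℕ) :
    (n : ℝ) ^ ((3 : ℝ) / 4) - (n : ℝ) ^ ((1 : ℝ) / 2) - (n : ℝ) ^ ((1 : ℝ) / 4) ≤
        ((Nat.sqrt n * Nat.sqrt (Nat.sqrt n) : ℕ) : ℝ) ∧
      ((Nat.sqrt n * Nat.sqrt (Nat.sqrt n) : ℕ) : ℝ) ≤ (n : ℝ) ^ ((3 : ℝ) / 4) := by
  have hn : (0 : ℝ) ≤ n := Nat.cast_nonneg n
  have hs1 := natSqrt_le_rpow_half n
  have hs2 := rpow_half_sub_one_le_natSqrt n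
  have hr1 := doubleSqrt_le_rpow_quarter n
  have hr2 := rpow_quarter_lt_doubleSqrt_add_one n
  have hmul : (n : ℝ) ^ ((1 : ℝ) / 2) * (n : ℝ) ^ ((1 : ℝ) / 4) = (n : ℝ) ^ ((3 : ℝ) / 4) := by
    rw [← Real.rpow_add' hn (by norm_num)]; norm_num
  have h14 : 0 ≤ (n : ℝ) ^ ((1 : ℝ) / 4) := Real.rpow_nonneg hn _
  have h12 : 0 ≤ (n : ℝ) ^ ((1 : ℝ) / 2) := Real.rpow_nonneg hn _
  push_cast
  constructor
  · -- `(√n - 1)(n^{1/4} - 1) ≤ s r`, expanded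
    have hs0 : (0 : ℝ) ≤ (Nat.sqrt n : ℕ) := Nat.cast_nonneg _
    have hr0 : (0 : ℝ) ≤ (Nat.sqrt (Nat.sqrt n) : ℕ) := Nat.cast_nonneg _
    nlinarith [mul_le_mul hs2 hr2.le (by linarith) hs0, hmul]
  · calc ((Nat.sqrt n : ℕ) : ℝ) * ((Nat.sqrt (Nat.sqrt n) : ℕ) : ℝ)
        ≤ (n : ℝ) ^ ((1 : ℝ) / 2) * (n : ℝ) ^ ((1 : ℝ) / 4) :=
          mul_le_mul hs1 hr1 (Nat.cast_nonneg _) h12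
      _ = (n : ℝ) ^ ((3 : ℝ) / 4) := hmul

/-! ### The schedule and its eventual inequalities

All parameters of the assembly are read off `n` through `q = ⌊n^{1/8}⌋` (the triple integer square
root) and `s = ⌊n^{1/2}⌋`: the Green/large threshold is `|S| ≤ s/q ≍ n^{3/8}`, the box-size and
divisor cut-offs are `2^q`, `2^{3q}`, the Vaughan parameter is `u = 2^{⌊n/8⌋}`, and the type-II lag
parameter is `ρ = ⌈(C+7)q/c⌉`. The lemma below collects, once and for all, the finitely many
numerical inequalities between these quantities that hold for all large `n`; every one of them
compares two different powers of `n^{1/8}` (or a power and a logarithm), so no constant needs tuning. -/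

set_option maxHeartbeats 1600000 in
-- one long chain of elementary inequalities; splitting it would only duplicate the shared set-up
/-- **The schedule inequalities, eventually in `n`.** With `X = n^{1/8}`, `q = ⌊X⌋`, `s = ⌊√n⌋`,
`ρ = ⌈(C+7)q/c⌉` and `M₀ = s/q - 1 - 3q` (a lower bound for the number of relevant digits), all
the displayed inequalities hold for `n` large. [folklore] -/
theorem schedule_eventually {c C c₂ cG : ℝ} (hc : 0 < c) (hC : 0 ≤ C) (hc₂ : 0 < c₂) (hcG : 0 < cG)
    (KG : ℝ) :
    ∀ᶠ n : ℕ in atTop,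
      let q : ℕ := Nat.sqrt (Nat.sqrt (Nat.sqrt n))
      let s : ℕ := Nat.sqrt n
      let ρ : ℕ := ⌈(C + 7) * (q : ℝ) / c⌉₊
      let M₀ : ℝ := (s : ℝ) / q - 1 - 3 * q
      (16 ≤ n ∧ 1 ≤ q ∧ 1 ≤ s) ∧
      (8 * ((n : ℝ) + 1) ^ 4 * (2 : ℝ) ^ ((n : ℝ) ^ ((1 : ℝ) / 10)) < (2 : ℝ) ^ q) ∧
      (n / 8 + 1 + q ≤ n ∧ 3 * q ≤ n ∧ 6 * (n / 8) + 3 * q ≤ n ∧ 2 * ρ + 2 ≤ n / 8) ∧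
      (2 * ((n : ℝ) + 1) ^ 3 ≤ (2 : ℝ) ^ q) ∧
      ((n : ℝ) * Real.exp (-(cG * q)) * (2 : ℝ) ^ ((n : ℝ) ^ ((1 : ℝ) / 10)) * (|KG| + 1) < 1) ∧
      (4 * (|KG| + 1) * Real.exp (-(cG * Real.sqrt n / 2)) * (2 : ℝ) ^ ((n : ℝ) ^ ((1 : ℝ) / 10)) < 1) ∧
      (C * ρ + (C + 7) * q ≤ c * ((n / 8 : ℕ) : ℝ) ∧ C * ρ ≤ ((n / 8 : ℕ) : ℝ) ∧ C * ρ ≤ c₂ * M₀ / 2 ∧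
        (C + 7) * q ≤ c * ρ) ∧
      (C * ρ + (C + 7) * q ≤ c * (M₀ / 24)) ∧
      (C * ρ + (C + 7) * q ≤ c * (c₂ * M₀ / (8 * (2 + Real.log ((n : ℝ) + 1) / Real.log 2)))) ∧
      (24 * ((n : ℝ) + 2) ^ 4 * (2 : ℝ) ^ (-(c₂ * M₀ / 2)) ≤ (2 : ℝ) ^ (-(4 * (q : ℝ)))) ∧
      (2 * (ρ : ℝ) + 2 ≤ c₂ * M₀ / 2 ∧ 0 ≤ M₀) := by
  -- constants (all thresholds are collected in `K₀`, a sum of nonnegative terms; no symbolic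
  -- division survives into the inequalities fed to `linarith`)
  have hcc : 0 < c * c := mul_pos hc hc
  have hcc₂ : 0 < c * c₂ := mul_pos hc hc₂
  have hccc₂ : 0 < c * c * c₂ := mul_pos hcc hc₂
  set D₆ : ℝ := (C + 7) * (C + c) + C * c + c * c with hD₆
  have hD₆0 : 0 < D₆ := by rw [hD₆]; positivity
  set D₇ : ℝ := (C + 7) * (C + c) + C * c with hD₇
  have hD₇0 : 0 ≤ D₇ := by rw [hD₇]; positivity
  have hlogKG : 0 ≤ Real.log (|KG| + 1) := Real.log_nonneg (by linarith [abs_nonneg KG])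
  have hlog4 : 0 < Real.log 4 := Real.log_pos (by norm_num)
  have hl2 : 0 < Real.log 2 := Real.log_pos (by norm_num)
  set k2 : ℝ := 40 / c₂ + 1 with hk2
  set k3 : ℝ := 2 * (cG + Real.log (|KG| + 1)) / cG + 1 with hk3
  set k4 : ℝ := 4 * (Real.log 4 + Real.log (|KG| + 1)) / cG + 1 with hk4
  set k5 : ℝ := 8 * D₆ / (c * c) + 1 with hk5
  set k6 : ℝ := 8 * (C * (C + 7) + C * c + c) / c + 1 with hk6
  set k7 : ℝ := 16 * D₇ / (c * c * c₂) + 4 with hk7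
  set k8 : ℝ := 48 * D₇ / (c * c) + 1 with hk8
  set k9 : ℝ := (8 * (C + 7) + 16 * c) / (c * c₂) + 1 with hk9
  set k10 : ℝ := 8 * (2 * (C + 7) + 5 * c) / c + 1 with hk10
  set k11 : ℝ := 4 * (C * (C + 7) + C * c) / (c * c₂) + 1 with hk11
  have hk2p : 0 ≤ k2 := by rw [hk2]; positivity
  have hk3p : 0 ≤ k3 := by rw [hk3]; positivity
  have hk4p : 0 ≤ k4 := by rw [hk4]; positivity
  have hk5p : 0 ≤ k5 := by rw [hk5]; positivity
  have hk6p : 0 ≤ k6 := by rw [hk6]; positivity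
  have hk7p : 0 ≤ k7 := by rw [hk7]; positivity
  have hk8p : 0 ≤ k8 := by rw [hk8]; positivity
  have hk9p : 0 ≤ k9 := by rw [hk9]; positivity
  have hk10p : 0 ≤ k10 := by rw [hk10]; positivity
  have hk11p : 0 ≤ k11 := by rw [hk11]; positivity
  set K₀ : ℝ := 16 + k2 + k3 + k4 + k5 + k6 + k7 + k8 + k9 + k10 + k11 with hK₀
  have hK₀16 : (16 : ℝ) ≤ K₀ := by
    rw [hK₀]; linarith only [hk2p, hk3p, hk4p, hk5p, hk6p, hk7p, hk8p, hk9p, hk10p, hk11p]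
  have hK₀0 : 0 ≤ K₀ := by linarith only [hK₀16]
  have hk2K : k2 ≤ K₀ := by
    rw [hK₀]; linarith only [hk3p, hk4p, hk5p, hk6p, hk7p, hk8p, hk9p, hk10p, hk11p]
  have hk3K : k3 ≤ K₀ := by
    rw [hK₀]; linarith only [hk2p, hk4p, hk5p, hk6p, hk7p, hk8p, hk9p, hk10p, hk11p]
  have hk4K : k4 ≤ K₀ := by
    rw [hK₀]; linarith only [hk2p, hk3p, hk5p, hk6p, hk7p, hk8p, hk9p, hk10p, hk11p]
  have hk5K : k5 ≤ K₀ := by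
    rw [hK₀]; linarith only [hk2p, hk3p, hk4p, hk6p, hk7p, hk8p, hk9p, hk10p, hk11p]
  have hk6K : k6 ≤ K₀ := by
    rw [hK₀]; linarith only [hk2p, hk3p, hk4p, hk5p, hk7p, hk8p, hk9p, hk10p, hk11p]
  have hk7K : k7 ≤ K₀ := by
    rw [hK₀]; linarith only [hk2p, hk3p, hk4p, hk5p, hk6p, hk8p, hk9p, hk10p, hk11p]
  have hk8K : k8 ≤ K₀ := by
    rw [hK₀]; linarith only [hk2p, hk3p, hk4p, hk5p, hk6p, hk7p, hk9p, hk10p, hk11p]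
  have hk9K : k9 ≤ K₀ := by
    rw [hK₀]; linarith only [hk2p, hk3p, hk4p, hk5p, hk6p, hk7p, hk8p, hk10p, hk11p]
  have hk10K : k10 ≤ K₀ := by
    rw [hK₀]; linarith only [hk2p, hk3p, hk4p, hk5p, hk6p, hk7p, hk8p, hk9p, hk11p]
  have hk11K : k11 ≤ K₀ := by
    rw [hK₀]; linarith only [hk2p, hk3p, hk4p, hk5p, hk6p, hk7p, hk8p, hk9p, hk10p]
  -- base eventual facts in the real variable `x = n`
  have hb1 := Filter.Eventually.natCast_atTop (eventually_ge_atTop (K₀ ^ (8 : ℕ)))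
  have hb2 := Filter.Eventually.natCast_atTop (eventually_const_mul_log_le_rpow (a := (1 : ℝ) / 8) (by norm_num)
    (64 / Real.log 2))
  have hb3 := Filter.Eventually.natCast_atTop (eventually_const_mul_log_le_rpow (a := (1 : ℝ) / 8) (by norm_num)
    (4 / cG))
  have hb4 := Filter.Eventually.natCast_atTop (eventually_const_mul_rpow_le_rpow (a := (1 : ℝ) / 10) (b := (1 : ℝ) / 8)
    (by norm_num) 8)
  have hb5 := Filter.Eventually.natCast_atTop (eventually_const_mul_rpow_le_rpow (a := (1 : ℝ) / 10) (b := (1 : ℝ) / 8)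
    (by norm_num) (4 * Real.log 2 / cG))
  have hb6 : ∀ᶠ n : ℕ in atTop, 16 ≤ n := eventually_ge_atTop 16
  filter_upwards [hb1, hb2, hb3, hb4, hb5, hb6] with n hn1 hn2 hn3 hn4 hn5 hn16
  intro q s ρ M₀
  -- the basic real variable `X = n^{1/8}`
  set X : ℝ := (n : ℝ) ^ ((1 : ℝ) / 8) with hX
  set y : ℝ := (n : ℝ) ^ ((1 : ℝ) / 10) with hy
  have hn0 : (0 : ℝ) < n := by exact_mod_cast (show 0 < n by omega)
  have hn0' : (0 : ℝ) ≤ n := hn0.le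
  have hn1' : (1 : ℝ) ≤ n := by exact_mod_cast (show 1 ≤ n by omega)
  have hX0 : 0 < X := Real.rpow_pos_of_pos hn0 _
  have hy0 : 0 ≤ y := Real.rpow_nonneg hn0' _
  have hXK : K₀ ≤ X := by
    calc K₀ = (K₀ ^ (8 : ℕ)) ^ ((1 : ℝ) / 8) := by
          rw [← Real.rpow_natCast, ← Real.rpow_mul hK₀0]; norm_num
      _ ≤ X := Real.rpow_le_rpow (by positivity) hn1 (by norm_num)
  have hX16 : 16 ≤ X := hK₀16.trans hXK
  have hX1 : 1 ≤ X := by linarith only [hX16]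
  have hXn : X ^ (8 : ℕ) = n := by
    rw [hX, ← Real.rpow_natCast, ← Real.rpow_mul hn0']; norm_num
  have hX4 : X ^ (4 : ℕ) = (n : ℝ) ^ ((1 : ℝ) / 2) := by
    rw [hX, ← Real.rpow_natCast, ← Real.rpow_mul hn0']; norm_num
  have hsqrtn : Real.sqrt n = X ^ (4 : ℕ) := by rw [hX4, Real.sqrt_eq_rpow]
  have hlogn : Real.log n = 8 * Real.log X := by
    rw [← hXn, Real.log_pow]; push_cast; ring
  -- thresholds
  have hk2X : k2 ≤ X := hk2K.trans hXK
  have hk3X : k3 ≤ X := hk3K.trans hXK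
  have hk4X : k4 ≤ X := hk4K.trans hXK
  have hk5X : k5 ≤ X := hk5K.trans hXK
  have hk6X : k6 ≤ X := hk6K.trans hXK
  have hk7X : k7 ≤ X := hk7K.trans hXK
  have hk8X : k8 ≤ X := hk8K.trans hXK
  have hk9X : k9 ≤ X := hk9K.trans hXK
  have hk10X : k10 ≤ X := hk10K.trans hXK
  have hk11X : k11 ≤ X := hk11K.trans hXK
  -- powers of `X`
  have hXX : X * X = X ^ (2 : ℕ) := by ring
  have hXX2 : X * X ^ (2 : ℕ) = X ^ (3 : ℕ) := by ring
  have hX8 : X * X ^ (7 : ℕ) = X ^ (8 : ℕ) := by ring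
  have hX2 : 16 * X ≤ X ^ (2 : ℕ) := by
    have h := mul_le_mul_of_nonneg_right hX16 hX0.le; linarith only [h, hXX]
  have hX2ge : X ≤ X ^ (2 : ℕ) := by linarith only [hX2, hX16]
  have hX3 : 256 * X ≤ X ^ (3 : ℕ) := by
    have h : 16 * X ^ (2 : ℕ) ≤ X * X ^ (2 : ℕ) := mul_le_mul_of_nonneg_right hX16 (by positivity)
    linarith only [h, hXX2, hX2]
  have hX4' : X ^ (2 : ℕ) ≤ X ^ (4 : ℕ) := pow_le_pow_right₀ hX1 (by norm_num)
  have hX7 : X ≤ X ^ (7 : ℕ) := le_self_pow₀ hX1 (by norm_num)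
  have hX27 : X ^ (2 : ℕ) ≤ X ^ (7 : ℕ) := pow_le_pow_right₀ hX1 (by norm_num)
  have hX16_8 : 16 * X ≤ X ^ (8 : ℕ) := by
    have h : 16 * X ≤ X * X := mul_le_mul_of_nonneg_right hX16 hX0.le
    have h' : X * X ≤ X * X ^ (7 : ℕ) := mul_le_mul_of_nonneg_left hX7 hX0.le
    linarith only [h, h', hX8]
  have hX2_8 : 16 * X ^ (2 : ℕ) ≤ X ^ (8 : ℕ) := by
    have h : 16 * X ^ (2 : ℕ) ≤ X * X ^ (2 : ℕ) := mul_le_mul_of_nonneg_right hX16 (by positivity)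
    have h' : X * X ^ (2 : ℕ) ≤ X * X ^ (7 : ℕ) := mul_le_mul_of_nonneg_left hX27 hX0.le
    linarith only [h, h', hX8]
  -- base facts rewritten in `X`
  have F1 : Real.log n ≤ Real.log 2 / 64 * X := by
    have h := hn2
    rw [div_mul_eq_mul_div, div_le_iff₀ hl2] at h
    linarith only [h]
  have F2 : Real.log n ≤ cG / 4 * X := by
    have h := hn3
    rw [div_mul_eq_mul_div, div_le_iff₀ hcG] at h
    linarith only [h]
  have F3 : y ≤ X / 8 := by linarith only [hn4]
  have F4 : Real.log 2 * y ≤ cG / 4 * X := by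
    have h := hn5
    rw [div_mul_eq_mul_div, div_le_iff₀ hcG] at h
    linarith only [h]
  have hlogX0 : 0 ≤ Real.log X := Real.log_nonneg hX1
  have hlogn0 : 0 ≤ Real.log n := by rw [hlogn]; positivity
  have hlog1 : Real.log ((n : ℝ) + 1) ≤ Real.log 2 + Real.log 2 / 64 * X := by
    have h1 : Real.log ((n : ℝ) + 1) ≤ Real.log (2 * n) :=
      Real.log_le_log (by positivity) (by linarith only [hn1'])
    rw [Real.log_mul (by norm_num) hn0.ne'] at h1
    linarith only [h1, F1]
  have hlogn1 : 0 ≤ Real.log ((n : ℝ) + 1) := Real.log_nonneg (by linarith only [hn1'])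
  have hlog2' : Real.log ((n : ℝ) + 2) ≤ 2 * Real.log 2 + Real.log 2 / 64 * X := by
    have h1 : Real.log ((n : ℝ) + 2) ≤ Real.log (4 * n) :=
      Real.log_le_log (by positivity) (by linarith only [hn1'])
    rw [Real.log_mul (by norm_num) hn0.ne', show (4 : ℝ) = 2 ^ 2 by norm_num, Real.log_pow] at h1
    push_cast at h1
    linarith only [h1, F1]
  -- the schedule quantities against `X`
  obtain ⟨hqX, hXq⟩ := tripleSqrt_le_rpow n
  change (q : ℝ) ≤ X at hqX
  change X < (q : ℝ) + 1 at hXq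
  have hsX : (s : ℝ) ≤ X ^ (4 : ℕ) := by rw [hX4]; exact natSqrt_le_rpow_half n
  have hXs : X ^ (4 : ℕ) - 1 ≤ (s : ℝ) := by rw [hX4]; exact rpow_half_sub_one_le_natSqrt n
  have hq1 : (1 : ℝ) ≤ q := by linarith only [hXq, hX16]
  have hq1n : 1 ≤ q := by exact_mod_cast hq1
  have hq0 : (0 : ℝ) < q := by linarith only [hq1]
  have hs1 : (1 : ℝ) ≤ s := by linarith only [hXs, hX4', hX2ge, hX16]
  have hs1n : 1 ≤ s := by exact_mod_cast hs1
  have hs0 : (0 : ℝ) < s := by linarith only [hs1]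
  -- `M₀ ≥ X³/2`
  have hM₀ : X ^ (3 : ℕ) / 2 ≤ M₀ := by
    change X ^ (3 : ℕ) / 2 ≤ (s : ℝ) / q - 1 - 3 * q
    have h1 : (X ^ (4 : ℕ) - 1) / X ≤ (s : ℝ) / q := by
      rw [div_le_div_iff₀ hX0 hq0]
      exact mul_le_mul hXs hqX hq0.le hs0.le
    have h2 : X ^ (3 : ℕ) - 1 ≤ (X ^ (4 : ℕ) - 1) / X := by
      rw [le_div_iff₀ hX0]
      have h3 : (X ^ (3 : ℕ) - 1) * X = X ^ (4 : ℕ) - X := by ring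
      linarith only [h3, hX1]
    linarith only [h1, h2, hqX, hX3, hX16]
  have hM₀0 : 0 ≤ M₀ := le_trans (by positivity) hM₀
  have hcM₀ : c₂ * (X ^ (3 : ℕ) / 2) ≤ c₂ * M₀ := mul_le_mul_of_nonneg_left hM₀ hc₂.le
  -- `ρ` (kept multiplied by `c`)
  have hρarg : 0 ≤ (C + 7) * (q : ℝ) / c := by positivity
  have hcρ_le : c * ρ ≤ (C + 7) * X + c := by
    have h1 : (ρ : ℝ) < (C + 7) * (q : ℝ) / c + 1 := Nat.ceil_lt_add_one hρarg
    have h2 : c * ρ < c * ((C + 7) * (q : ℝ) / c + 1) := mul_lt_mul_of_pos_left h1 hc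
    have h3 : c * ((C + 7) * (q : ℝ) / c + 1) = (C + 7) * q + c := by field_simp
    have h4 := mul_le_mul_of_nonneg_left hqX (show 0 ≤ C + 7 by positivity)
    linarith only [h2, h3, h4]
  have hρ_ge : (C + 7) * (q : ℝ) ≤ c * ρ := by
    have h1 : (C + 7) * (q : ℝ) / c ≤ ρ := Nat.le_ceil _
    rw [div_le_iff₀ hc] at h1
    linarith only [h1]
  have hρ0 : (0 : ℝ) ≤ ρ := Nat.cast_nonneg _
  have hcCρ : c * (C * ρ) ≤ C * (C + 7) * X + C * c := by
    have h := mul_le_mul_of_nonneg_left hcρ_le hC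
    linarith only [h]
  have h7q : (C + 7) * (q : ℝ) ≤ (C + 7) * X := mul_le_mul_of_nonneg_left hqX (by positivity)
  have hc7q : c * ((C + 7) * (q : ℝ)) ≤ c * ((C + 7) * X) := mul_le_mul_of_nonneg_left h7q hc.le
  -- `n / 8`
  have hdiv_le : ((n / 8 : ℕ) : ℝ) ≤ (n : ℝ) / 8 := by
    have h : (n / 8) * 8 ≤ n := Nat.div_mul_le_self n 8
    have h' : ((n / 8 : ℕ) : ℝ) * 8 ≤ n := by exact_mod_cast h
    linarith only [h']
  have hdiv_ge : (n : ℝ) / 8 - 1 ≤ ((n / 8 : ℕ) : ℝ) := by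
    have h : n < n / 8 * 8 + 8 := Nat.lt_div_mul_add (by norm_num)
    have h' : (n : ℝ) < ((n / 8 : ℕ) : ℝ) * 8 + 8 := by exact_mod_cast h
    linarith only [h']
  have hdiv_le' : ((n / 8 : ℕ) : ℝ) ≤ X ^ (8 : ℕ) / 8 := by rw [hXn]; exact hdiv_le
  have hdiv_ge' : X ^ (8 : ℕ) / 8 - 1 ≤ ((n / 8 : ℕ) : ℝ) := by rw [hXn]; exact hdiv_ge
  ------------------------------------------------------------------
  -- E-block: natural-number inequalities
  have hE2 : n / 8 + 1 + q ≤ n := by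
    have h : ((n / 8 + 1 + q : ℕ) : ℝ) ≤ n := by
      push_cast; rw [← hXn]; linarith only [hdiv_le', hqX, hX16_8, hX16]
    exact_mod_cast h
  have hE4 : 3 * q ≤ n := by
    have h : ((3 * q : ℕ) : ℝ) ≤ n := by
      push_cast; rw [← hXn]; linarith only [hqX, hX16_8, hX16]
    exact_mod_cast h
  have hE11a : 6 * (n / 8) + 3 * q ≤ n := by
    have h : ((6 * (n / 8) + 3 * q : ℕ) : ℝ) ≤ n := by
      push_cast; rw [← hXn]; linarith only [hdiv_le', hqX, hX16_8, hX16]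
    exact_mod_cast h
  have hE13 : 2 * ρ + 2 ≤ n / 8 := by
    have h : ((2 * ρ + 2 : ℕ) : ℝ) ≤ ((n / 8 : ℕ) : ℝ) := by
      push_cast
      -- multiply by `c`
      refine le_of_mul_le_mul_left ?_ hc
      rw [hk10] at hk10X
      have h3 : 8 * (2 * (C + 7) + 5 * c) / c ≤ X ^ (7 : ℕ) := by linarith only [hk10X, hX7]
      rw [div_le_iff₀ hc] at h3
      have h4 : X * (8 * (2 * (C + 7) + 5 * c)) ≤ X * (X ^ (7 : ℕ) * c) := mul_le_mul_of_nonneg_left h3 hX0.le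
      have h5 : X * (X ^ (7 : ℕ) * c) = c * X ^ (8 : ℕ) := by ring
      have h6 := mul_le_mul_of_nonneg_left hdiv_ge' hc.le
      have hcX : c * 1 ≤ c * X := mul_le_mul_of_nonneg_left hX1 hc.le
      linarith only [hcρ_le, h4, h5, h6, hcX, hc]
    exact_mod_cast h
  ------------------------------------------------------------------
  -- E-block: `2^q` versus polynomials in `n`
  have h2q : Real.log ((2 : ℝ) ^ q) = q * Real.log 2 := by rw [Real.log_pow]
  have hXql : X * Real.log 2 < q * Real.log 2 + Real.log 2 := by
    have h := mul_lt_mul_of_pos_right hXq hl2; linarith only [h]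
  have hX16l : 16 * Real.log 2 ≤ X * Real.log 2 := mul_le_mul_of_nonneg_right hX16 hl2.le
  have hE3 : (n : ℝ) + 1 ≤ (2 : ℝ) ^ q := by
    rw [← Real.log_le_log_iff (by positivity) (by positivity), h2q]
    linarith only [hlog1, hXql, hX16l, hl2]
  have hE10 : 2 * ((n : ℝ) + 1) ^ 3 ≤ (2 : ℝ) ^ q := by
    rw [← Real.log_le_log_iff (by positivity) (by positivity), h2q,
      Real.log_mul (by norm_num) (by positivity), Real.log_pow]
    push_cast
    linarith only [hlog1, hXql, hX16l, hl2]
  have hyl : y * Real.log 2 ≤ X / 8 * Real.log 2 := mul_le_mul_of_nonneg_right F3 hl2.le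
  have hE1 : 8 * ((n : ℝ) + 1) ^ 4 * (2 : ℝ) ^ y < (2 : ℝ) ^ q := by
    rw [← Real.log_lt_log_iff (by positivity) (by positivity), h2q,
      Real.log_mul (by positivity) (by positivity), Real.log_mul (by norm_num) (by positivity),
      Real.log_pow, Real.log_rpow (by norm_num), show (8 : ℝ) = 2 ^ 3 by norm_num, Real.log_pow]
    push_cast
    linarith only [hlog1, hXql, hX16l, hyl, hl2]
  ------------------------------------------------------------------
  -- E-block: Green side
  have hyc : y * Real.log 2 = Real.log 2 * y := mul_comm _ _
  have hE5 : (n : ℝ) * Real.exp (-(cG * q)) * (2 : ℝ) ^ y * (|KG| + 1) < 1 := by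
    have hpos : 0 < (n : ℝ) * Real.exp (-(cG * q)) * (2 : ℝ) ^ y * (|KG| + 1) := by positivity
    rw [← Real.log_neg_iff hpos, Real.log_mul (by positivity) (by positivity),
      Real.log_mul (by positivity) (by positivity), Real.log_mul (by positivity) (by positivity),
      Real.log_exp, Real.log_rpow (by norm_num)]
    have h1 : cG * X < cG * q + cG := by
      have h := mul_lt_mul_of_pos_left hXq hcG; linarith only [h]
    rw [hk3] at hk3X
    have h3 : 2 * (cG + Real.log (|KG| + 1)) / cG ≤ X - 1 := by linarith only [hk3X]
    rw [div_le_iff₀ hcG] at h3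
    linarith only [F2, F4, h1, h3, hyc, hcG, hlogKG]
  have hE5' : 4 * (|KG| + 1) * Real.exp (-(cG * Real.sqrt n / 2)) * (2 : ℝ) ^ y < 1 := by
    have hpos : 0 < 4 * (|KG| + 1) * Real.exp (-(cG * Real.sqrt n / 2)) * (2 : ℝ) ^ y := by positivity
    rw [← Real.log_neg_iff hpos, Real.log_mul (by positivity) (by positivity),
      Real.log_mul (by positivity) (by positivity), Real.log_mul (by positivity) (by positivity),
      Real.log_exp, Real.log_rpow (by norm_num), hsqrtn]
    rw [hk4] at hk4X
    have h3 : 4 * (Real.log 4 + Real.log (|KG| + 1)) / cG ≤ X - 1 := by linarith only [hk4X]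
    rw [div_le_iff₀ hcG] at h3
    have hX14 : X ≤ X ^ (4 : ℕ) := le_self_pow₀ hX1 (by norm_num)
    have h5 : (X - 1) * cG < X ^ (4 : ℕ) * cG := mul_lt_mul_of_pos_right (by linarith only [hX14]) hcG
    have h6 := mul_le_mul_of_nonneg_left hX14 hcG.le
    linarith only [F4, h3, hyc, h5, h6, hlog4, hlogKG]
  ------------------------------------------------------------------
  -- E-block: type II parameters (all divided by nothing: we compare `c ×` both sides)
  have hCcX : C * c + c * c ≤ (C * c + c * c) * X := by
    have h := mul_le_mul_of_nonneg_left hX1 (show 0 ≤ C * c + c * c by positivity); linarith only [h]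
  have hD₆X : D₆ * X = (C + 7) * (C + c) * X + (C * c + c * c) * X := by rw [hD₆]; ring
  have hD₇X : D₇ * X = (C + 7) * (C + c) * X + (C * c) * X := by rw [hD₇]; ring
  -- `c (C ρ + (C+7) q) ≤ D₇ X + ... `
  have hkey : c * (C * ρ + (C + 7) * q) ≤ (C + 7) * (C + c) * X + C * c := by
    have h' : c * (C * ρ + (C + 7) * q) = c * (C * ρ) + c * ((C + 7) * q) := by ring
    have h'' : c * ((C + 7) * X) + (C * (C + 7) * X) = (C + 7) * (C + c) * X := by ring
    linarith only [hcCρ, hc7q, h', h'']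
  have hkeyD₇ : c * (C * ρ + (C + 7) * q) ≤ D₇ * X := by
    have h := mul_le_mul_of_nonneg_left hX1 (show 0 ≤ C * c by positivity)
    linarith only [hkey, hD₇X, h]
  have hE6 : C * ρ + (C + 7) * q ≤ c * ((n / 8 : ℕ) : ℝ) := by
    refine le_of_mul_le_mul_left ?_ hc
    rw [hk5] at hk5X
    have h3 : 8 * D₆ / (c * c) ≤ X ^ (7 : ℕ) := by linarith only [hk5X, hX7]
    rw [div_le_iff₀ hcc] at h3
    have h4 : X * (8 * D₆) ≤ X * (X ^ (7 : ℕ) * (c * c)) := mul_le_mul_of_nonneg_left h3 hX0.le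
    have h5 : X * (X ^ (7 : ℕ) * (c * c)) = c * c * X ^ (8 : ℕ) := by ring
    have h6 := mul_le_mul_of_nonneg_left hdiv_ge' hcc.le
    have h7 : c * (c * ((n / 8 : ℕ) : ℝ)) = c * c * ((n / 8 : ℕ) : ℝ) := by ring
    linarith only [hkey, hCcX, hD₆X, h4, h5, h6, h7]
  have hE6' : C * ρ ≤ ((n / 8 : ℕ) : ℝ) := by
    refine le_of_mul_le_mul_left ?_ hc
    rw [hk6] at hk6X
    have h3 : 8 * (C * (C + 7) + C * c + c) / c ≤ X ^ (7 : ℕ) := by linarith only [hk6X, hX7]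
    rw [div_le_iff₀ hc] at h3
    have h4 : X * (8 * (C * (C + 7) + C * c + c)) ≤ X * (X ^ (7 : ℕ) * c) := mul_le_mul_of_nonneg_left h3 hX0.le
    have h5 : X * (X ^ (7 : ℕ) * c) = c * X ^ (8 : ℕ) := by ring
    have h6 := mul_le_mul_of_nonneg_left hdiv_ge' hc.le
    have h8 := mul_le_mul_of_nonneg_left hX1 (show 0 ≤ C * c + c by positivity)
    linarith only [hcCρ, h4, h5, h6, h8]
  have hE6'' : C * ρ ≤ c₂ * M₀ / 2 := by
    refine le_of_mul_le_mul_left ?_ hc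
    rw [hk11] at hk11X
    have h3 : 4 * (C * (C + 7) + C * c) / (c * c₂) ≤ X := by linarith only [hk11X]
    rw [div_le_iff₀ hcc₂] at h3
    have h4 := mul_le_mul_of_nonneg_right h3 (sq_nonneg X)
    have h5 : X * (c * c₂) * X ^ 2 = c * c₂ * X ^ (3 : ℕ) := by ring
    have h6 := mul_le_mul_of_nonneg_left hX2ge (show 0 ≤ C * (C + 7) + C * c by positivity)
    have h7 := mul_le_mul_of_nonneg_left hX1 (show 0 ≤ C * c by positivity)
    have h8 := mul_le_mul_of_nonneg_left hcM₀ hc.le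
    have h9 : c * (c₂ * M₀ / 2) = c * (c₂ * M₀) / 2 := by ring
    linarith only [hcCρ, h4, h5, h6, h7, h8, h9]
  have hE7 : C * ρ + (C + 7) * q ≤ c * (M₀ / 24) := by
    refine le_of_mul_le_mul_left ?_ hc
    rw [hk8] at hk8X
    have h3 : 48 * D₇ / (c * c) ≤ X := by linarith only [hk8X]
    rw [div_le_iff₀ hcc] at h3
    have h4 := mul_le_mul_of_nonneg_right h3 (sq_nonneg X)
    have h5 : X * (c * c) * X ^ 2 = c * c * X ^ (3 : ℕ) := by ring
    have h6 := mul_le_mul_of_nonneg_left hX2ge hD₇0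
    have h8 := mul_le_mul_of_nonneg_left hM₀ hcc.le
    have h9 : c * (c * (M₀ / 24)) = c * c * M₀ / 24 := by ring
    linarith only [hkeyD₇, h4, h5, h6, h8, h9]
  have hE8 : C * ρ + (C + 7) * q ≤ c * (c₂ * M₀ / (8 * (2 + Real.log ((n : ℝ) + 1) / Real.log 2))) := by
    have hden_le : 2 + Real.log ((n : ℝ) + 1) / Real.log 2 ≤ X := by
      have h1 : Real.log ((n : ℝ) + 1) / Real.log 2 ≤ 1 + X / 64 := by
        rw [div_le_iff₀ hl2]
        have h' : (1 + X / 64) * Real.log 2 = Real.log 2 + Real.log 2 / 64 * X := by ring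
        linarith only [hlog1, h']
      linarith only [h1, hX16]
    have hden_pos : 0 < 2 + Real.log ((n : ℝ) + 1) / Real.log 2 := by positivity
    refine le_of_mul_le_mul_left ?_ hc
    have h2 : D₇ * X ≤ c * c * (c₂ * (X ^ (3 : ℕ) / 2) / (8 * X)) := by
      rw [mul_div_assoc', le_div_iff₀ (by positivity)]
      rw [hk7] at hk7X
      have h3 : 16 * D₇ / (c * c * c₂) ≤ X := by linarith only [hk7X]
      rw [div_le_iff₀ hccc₂] at h3
      have h4 := mul_le_mul_of_nonneg_right h3 (sq_nonneg X)
      have h5 : D₇ * X * (8 * X) = 8 * D₇ * X ^ 2 := by ring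
      have h6 : X * (c * c * c₂) * X ^ 2 = c * c * c₂ * X ^ (3 : ℕ) := by ring
      have h7 : c * c * (c₂ * (X ^ (3 : ℕ) / 2)) = c * c * c₂ * X ^ (3 : ℕ) / 2 := by ring
      linarith only [h4, h5, h6, h7]
    have h4 : c * c * (c₂ * (X ^ (3 : ℕ) / 2) / (8 * X)) ≤
        c * c * (c₂ * M₀ / (8 * (2 + Real.log ((n : ℝ) + 1) / Real.log 2))) := by
      refine mul_le_mul_of_nonneg_left ?_ hcc.le
      calc c₂ * (X ^ (3 : ℕ) / 2) / (8 * X) ≤ c₂ * M₀ / (8 * X) := by gcongr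
        _ ≤ c₂ * M₀ / (8 * (2 + Real.log ((n : ℝ) + 1) / Real.log 2)) := by
            apply div_le_div_of_nonneg_left (by positivity) (by positivity)
            gcongr
    have h9 : c * (c * (c₂ * M₀ / (8 * (2 + Real.log ((n : ℝ) + 1) / Real.log 2)))) =
        c * c * (c₂ * M₀ / (8 * (2 + Real.log ((n : ℝ) + 1) / Real.log 2))) := by ring
    linarith only [hkeyD₇, h2, h4, h9]
  have hE9 : 24 * ((n : ℝ) + 2) ^ 4 * (2 : ℝ) ^ (-(c₂ * M₀ / 2)) ≤ (2 : ℝ) ^ (-(4 * (q : ℝ))) := by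
    rw [← Real.log_le_log_iff (by positivity) (by positivity), Real.log_mul (by positivity) (by positivity),
      Real.log_mul (by norm_num) (by positivity), Real.log_pow, Real.log_rpow (by norm_num),
      Real.log_rpow (by norm_num)]
    push_cast
    have hlog24 : Real.log 24 < 5 * Real.log 2 := by
      have h : Real.log 24 < Real.log 32 := Real.log_lt_log (by norm_num) (by norm_num)
      rw [show (32 : ℝ) = 2 ^ 5 by norm_num, Real.log_pow] at h
      push_cast at h; linarith only [h]
    rw [hk2] at hk2X
    have h3 : 40 / c₂ ≤ X := by linarith only [hk2X]
    rw [div_le_iff₀ hc₂] at h3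
    -- `13 + 5X ≤ 10 X² ≤ c₂ X³/4 ≤ c₂ M₀ /2`
    have hA : 10 * X ^ (2 : ℕ) ≤ c₂ * X ^ (3 : ℕ) / 4 := by
      have h4 := mul_le_mul_of_nonneg_right h3 (sq_nonneg X)
      have h5 : X * c₂ * X ^ 2 = c₂ * X ^ (3 : ℕ) := by ring
      linarith only [h4, h5]
    have hB : 13 + 5 * X ≤ 10 * X ^ (2 : ℕ) := by linarith only [hX2, hX16]
    have hD : (13 + 5 * X) * Real.log 2 ≤ (c₂ * M₀ / 2) * Real.log 2 :=
      mul_le_mul_of_nonneg_right (by linarith only [hA, hB, hcM₀]) hl2.le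
    have hql : (q : ℝ) * Real.log 2 ≤ X * Real.log 2 := mul_le_mul_of_nonneg_right hqX hl2.le
    have h' : (13 + 5 * X) * Real.log 2 = 13 * Real.log 2 + 5 * (X * Real.log 2) := by ring
    linarith only [hlog24, hlog2', hD, hql, h', hX16l, hl2]
  have hE11b : 2 * (ρ : ℝ) + 2 ≤ c₂ * M₀ / 2 := by
    refine le_of_mul_le_mul_left ?_ hc
    rw [hk9] at hk9X
    have h3 : (8 * (C + 7) + 16 * c) / (c * c₂) ≤ X := by linarith only [hk9X]
    rw [div_le_iff₀ hcc₂] at h3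
    have h4 := mul_le_mul_of_nonneg_right h3 (sq_nonneg X)
    have h5 : X * (c * c₂) * X ^ 2 = c * c₂ * X ^ (3 : ℕ) := by ring
    have h6 := mul_le_mul_of_nonneg_left hX2ge (show 0 ≤ 2 * (C + 7) + 4 * c by positivity)
    have h8 := mul_le_mul_of_nonneg_left hcM₀ hc.le
    have h9 : c * (c₂ * M₀ / 2) = c * (c₂ * M₀) / 2 := by ring
    have h10 : c * (2 * (ρ : ℝ) + 2) = 2 * (c * ρ) + 2 * c := by ring
    have hcX16 : c * 16 ≤ c * X := mul_le_mul_of_nonneg_left hX16 hc.le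
    linarith only [hcρ_le, h4, h5, h6, h8, h9, h10, hcX16, hc]
  exact ⟨⟨hn16, hq1n, hs1n⟩, hE1, ⟨hE2, hE4, hE11a, hE13⟩, hE10, hE5, hE5', ⟨hE6, hE6', hE6'', hρ_ge⟩,
    hE7, hE8, hE9, ⟨hE11b, hM₀0⟩⟩

open Literature.NumberTheory.LFunctions.MoebiusWalshVaughan (natWalsh dyBlock mem_dyBlock boxSum
  abs_natWalsh typeICoeff typeIICoeffA typeIICoeffB)

/-! ### Numerical form of the three savings of a type-II bound -/

/-- **The three savings are `≤ 2^{-5q}`**: if `L ≤ 2^q` (`L ≥ 1`, `q ≥ 1`), `(C+7)q ≤ cρ`,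
`Cρ + (C+7)q ≤ ci` and `Cρ + (C+7)q ≤ cd`, then
`L^C (2^{-cρ} + 2^{Cρ-ci} + 2^{Cρ-cd}) ≤ 2^{-5q}`. [folklore] -/
theorem three_terms_le {c C L d : ℝ} {q ρ i : ℕ} (hC : 0 ≤ C) (hq : 1 ≤ q) (hL1 : 1 ≤ L)
    (hL : L ≤ (2 : ℝ) ^ q) (h1 : (C + 7) * q ≤ c * ρ) (h2 : C * ρ + (C + 7) * q ≤ c * i)
    (h3 : C * ρ + (C + 7) * q ≤ c * d) :
    L ^ C * ((2 : ℝ) ^ (-(c * ρ)) + (2 : ℝ) ^ (C * ρ - c * i) + (2 : ℝ) ^ (C * ρ - c * d)) ≤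
      (2 : ℝ) ^ (-(5 * (q : ℝ))) := by
  have h2pos : (0 : ℝ) < 2 := by norm_num
  have hL0 : 0 ≤ L := by linarith
  have hCρ : 0 ≤ C * ρ := by positivity
  -- `L^C ≤ 2^{Cq}`
  have hLC : L ^ C ≤ (2 : ℝ) ^ (C * q) := by
    calc L ^ C ≤ ((2 : ℝ) ^ q) ^ C := Real.rpow_le_rpow hL0 hL hC
      _ = (2 : ℝ) ^ (C * q) := by
          rw [← Real.rpow_natCast, ← Real.rpow_mul h2pos.le]; ring_nf
  -- each saving is `≤ 2^{-(C+7)q}`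
  have hE : ∀ e : ℝ, e ≤ -((C + 7) * q) → (2 : ℝ) ^ e ≤ (2 : ℝ) ^ (-((C + 7) * (q : ℝ))) :=
    fun e he => Real.rpow_le_rpow_of_exponent_le one_le_two he
  have t1 := hE (-(c * ρ)) (by linarith)
  have t2 := hE (C * ρ - c * i) (by linarith)
  have t3 := hE (C * ρ - c * d) (by linarith)
  have hsum : (2 : ℝ) ^ (-(c * ρ)) + (2 : ℝ) ^ (C * ρ - c * i) + (2 : ℝ) ^ (C * ρ - c * d) ≤
      3 * (2 : ℝ) ^ (-((C + 7) * (q : ℝ))) := by linarith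
  have h3le : (3 : ℝ) ≤ (2 : ℝ) ^ (2 * (q : ℝ)) := by
    have hq' : (2 : ℝ) ≤ 2 * (q : ℝ) := by
      have : (1 : ℝ) ≤ q := by exact_mod_cast hq
      linarith
    calc (3 : ℝ) ≤ 4 := by norm_num
      _ = (2 : ℝ) ^ (2 : ℝ) := by norm_num
      _ ≤ (2 : ℝ) ^ (2 * (q : ℝ)) := Real.rpow_le_rpow_of_exponent_le one_le_two hq'
  calc L ^ C * ((2 : ℝ) ^ (-(c * ρ)) + (2 : ℝ) ^ (C * ρ - c * i) + (2 : ℝ) ^ (C * ρ - c * d))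
      ≤ (2 : ℝ) ^ (C * q) * (3 * (2 : ℝ) ^ (-((C + 7) * (q : ℝ)))) :=
        mul_le_mul hLC hsum (by positivity) (by positivity)
    _ ≤ (2 : ℝ) ^ (C * q) * ((2 : ℝ) ^ (2 * (q : ℝ)) * (2 : ℝ) ^ (-((C + 7) * (q : ℝ)))) := by
        gcongr
    _ = (2 : ℝ) ^ (-(5 * (q : ℝ))) := by
        rw [← Real.rpow_add h2pos, ← Real.rpow_add h2pos]; ring_nf

/-! ### The Cauchy–Schwarz numerics for a type-I box -/

/-- If `F ≤ 2^{i+j} G` and `1 + log 2^{i+1} ≤ n + 1`, then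
`√(2^{i+1}(1 + log 2^{i+1})³) √(2^j F) ≤ 2^{i+j} √(2(n+1)³ G)`. [folklore] -/
theorem cs_numeric {i j n : ℕ} {F G : ℝ} (hF : F ≤ 2 ^ (i + j) * G)
    (hlog : 1 + Real.log ((2 : ℝ) ^ (i + 1)) ≤ n + 1) :
    Real.sqrt (2 ^ (i + 1) * (1 + Real.log (2 ^ (i + 1))) ^ 3) * Real.sqrt (2 ^ j * F) ≤
      2 ^ (i + j) * Real.sqrt (2 * ((n : ℝ) + 1) ^ 3 * G) := by
  have hlog0 : 0 ≤ 1 + Real.log ((2 : ℝ) ^ (i + 1)) := by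
    have := Real.log_nonneg (one_le_pow₀ (M₀ := ℝ) one_le_two (n := i + 1)); linarith
  have h1 : (2 : ℝ) ^ (i + 1) * (1 + Real.log (2 ^ (i + 1))) ^ 3 ≤ 2 ^ (i + 1) * ((n : ℝ) + 1) ^ 3 := by
    gcongr
  have h2 : (2 : ℝ) ^ j * F ≤ 2 ^ j * (2 ^ (i + j) * G) := by gcongr
  calc Real.sqrt (2 ^ (i + 1) * (1 + Real.log (2 ^ (i + 1))) ^ 3) * Real.sqrt (2 ^ j * F)
      ≤ Real.sqrt (2 ^ (i + 1) * ((n : ℝ) + 1) ^ 3) * Real.sqrt (2 ^ j * (2 ^ (i + j) * G)) := by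
        gcongr
    _ = Real.sqrt ((2 ^ (i + 1) * ((n : ℝ) + 1) ^ 3) * (2 ^ j * (2 ^ (i + j) * G))) :=
        (Real.sqrt_mul (by positivity) _).symm
    _ = Real.sqrt (((2 : ℝ) ^ (i + j)) ^ 2 * (2 * ((n : ℝ) + 1) ^ 3 * G)) := by
        congr 1; ring
    _ = 2 ^ (i + j) * Real.sqrt (2 * ((n : ℝ) + 1) ^ 3 * G) := by
        rw [Real.sqrt_mul (by positivity), Real.sqrt_sq (by positivity)]

/-! ### Signs: `∑_a |F_a|` is a box sum with `±1` coefficients -/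

/-- `∑_{a ∈ D_i} |∑_{b ∈ D_j} w_T(ab)| = boxSum T i j ε 1` with the signs `ε_a = sgn(∑_b w_T(ab))`.
[folklore] -/
theorem sum_abs_eq_boxSum_sign (T : Finset ℕ) (i j : ℕ) :
    ∑ a ∈ dyBlock i, |∑ b ∈ dyBlock j, natWalsh T (a * b)| =
      boxSum T i j (fun a => if 0 ≤ ∑ b ∈ dyBlock j, natWalsh T (a * b) then 1 else -1) (fun _ => 1) := by
  unfold boxSum
  refine Finset.sum_congr rfl fun a _ => ?_
  have h : ∑ b ∈ dyBlock j, (if 0 ≤ ∑ b ∈ dyBlock j, natWalsh T (a * b) then (1 : ℝ) else -1) * 1 *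
      natWalsh T (a * b) =
      (if 0 ≤ ∑ b ∈ dyBlock j, natWalsh T (a * b) then (1 : ℝ) else -1) * ∑ b ∈ dyBlock j, natWalsh T (a * b) := by
    rw [Finset.mul_sum]
    refine Finset.sum_congr rfl fun b _ => by ring
  rw [h]
  split_ifs with hs
  · rw [abs_of_nonneg hs, one_mul]
  · rw [abs_of_neg (not_le.mp hs)]; ring

/-- The signs are `1`-bounded. [folklore] -/
theorem abs_sign_le_one (T : Finset ℕ) (j a : ℕ) :
    |(if 0 ≤ ∑ b ∈ dyBlock j, natWalsh T (a * b) then (1 : ℝ) else -1)| ≤ 1 := by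
  split_ifs <;> simp

/-! ### Windows: a covering family and the pigeonhole -/

/-- **A covering family of admissible windows.** For `1 ≤ i`, `1 ≤ ρ`, `w = 2ρ + 1`, `w + 1 ≤ j`,
the windows `[K, K + i + w)` with `K = ti`, `0 ≤ t ≤ t* = ⌊(j-w-1)/i⌋` ("middle") and `K = j - ρ`
("top") cover `[0, i + j + 2)`; hence for a digit set `T ⊆ [0, i+j+2)` one of these `t* + 2` windows
carries at least `|T|/(t* + 2)` of its elements. Middle windows satisfy `K + w + 1 ≤ j`, the top one
`j + 2 ≤ K + w` and `K + ρ ≤ j`, and all satisfy `K = 0 ∨ i ≤ K + ρ`. [folklore] -/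
theorem exists_dense_window (T : Finset ℕ) {i j ρ : ℕ} (hi : 1 ≤ i) (hij : i ≤ j) (hρ : 1 ≤ ρ)
    (hjw : 2 * ρ + 1 + 1 ≤ j) (hT : ∀ t ∈ T, t < i + j + 2) :
    ∃ K : ℕ, (K = 0 ∨ i ≤ K + ρ) ∧
      (K + (2 * ρ + 1) + 1 ≤ j ∨ (j + 2 ≤ K + (2 * ρ + 1) ∧ K + ρ ≤ j)) ∧
      (T.card : ℝ) ≤ (((j - (2 * ρ + 1) - 1) / i + 2 : ℕ) : ℝ) *
        (T.filter (fun t => K ≤ t ∧ t < K + i + (2 * ρ + 1))).card := by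
  classical
  set w : ℕ := 2 * ρ + 1 with hw
  set tstar : ℕ := (j - w - 1) / i with htstar
  -- the family of window origins
  set fam : Finset ℕ := insert (j - ρ) ((range (tstar + 1)).image (fun t : ℕ => (t * i : ℕ))) with hfam
  have hcard_fam : fam.card ≤ tstar + 2 := by
    rw [hfam]
    calc (insert (j - ρ) ((range (tstar + 1)).image (fun t : ℕ => (t * i : ℕ)))).card
        ≤ ((range (tstar + 1)).image (fun t : ℕ => (t * i : ℕ))).card + 1 := Finset.card_insert_le _ _
      _ ≤ (range (tstar + 1)).card + 1 := Nat.add_le_add_right Finset.card_image_le 1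
      _ = tstar + 2 := by rw [Finset.card_range]
  -- covering
  have hcover : ∀ x, x < i + j + 2 → ∃ K ∈ fam, K ≤ x ∧ x < K + i + w := by
    intro x hx
    by_cases hx1 : x < (tstar + 1) * i + w
    · -- a middle window: `t = min (x / i) tstar`
      set t := min (x / i) tstar with ht
      refine ⟨t * i, ?_, ?_, ?_⟩
      · rw [hfam, Finset.mem_insert, Finset.mem_image]
        exact Or.inr ⟨t, Finset.mem_range.mpr (by omega), rfl⟩
      · have h1 : t ≤ x / i := min_le_left _ _
        calc t * i ≤ (x / i) * i := Nat.mul_le_mul_right i h1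
          _ ≤ x := Nat.div_mul_le_self x i
      · rcases le_or_gt (x / i) tstar with hle | hgt
        · have ht' : t = x / i := min_eq_left hle
          rw [ht']
          have := Nat.lt_div_mul_add (a := x) hi
          rw [mul_comm] at this
          have : x < x / i * i + i := by
            have h := Nat.div_add_mod x i
            have h' := Nat.mod_lt x hi
            rw [mul_comm] at h
            omega
          omega
        · have ht' : t = tstar := min_eq_right hgt.le
          rw [ht']
          have hxi : (tstar + 1) * i ≤ x := by
            have : tstar + 1 ≤ x / i := hgt
            calc (tstar + 1) * i ≤ (x / i) * i := Nat.mul_le_mul_right i this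
              _ ≤ x := Nat.div_mul_le_self x i
          rw [add_mul, one_mul] at hx1
          omega
    · -- the top window
      refine ⟨j - ρ, by rw [hfam]; exact Finset.mem_insert_self _ _, ?_, ?_⟩
      · -- `x ≥ (t*+1) i + w > j - 1`
        have h1 : j - w - 1 < tstar * i + i := by rw [htstar]; exact Nat.lt_div_mul_add hi
        rw [add_mul, one_mul] at hx1
        omega
      · omega
  -- pigeonhole
  have hsub : T ⊆ fam.biUnion (fun K => T.filter (fun t => K ≤ t ∧ t < K + i + w)) := by
    intro t ht
    obtain ⟨K, hK, h1, h2⟩ := hcover t (hT t ht)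
    rw [Finset.mem_biUnion]
    exact ⟨K, hK, Finset.mem_filter.mpr ⟨ht, h1, h2⟩⟩
  have hsum : (T.card : ℝ) ≤ ∑ K ∈ fam, ((T.filter (fun t => K ≤ t ∧ t < K + i + w)).card : ℝ) := by
    have h1 : T.card ≤ ∑ K ∈ fam, (T.filter (fun t => K ≤ t ∧ t < K + i + w)).card :=
      (Finset.card_le_card hsub).trans Finset.card_biUnion_le
    exact_mod_cast h1
  have hfam_ne : fam.Nonempty := ⟨j - ρ, by rw [hfam]; exact Finset.mem_insert_self _ _⟩
  -- some window carries `≥ |T| / |fam|`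
  obtain ⟨K, hKfam, hK⟩ : ∃ K ∈ fam, (T.card : ℝ) / fam.card ≤
      ((T.filter (fun t => K ≤ t ∧ t < K + i + w)).card : ℝ) := by
    apply Finset.exists_le_of_sum_le hfam_ne
    rw [Finset.sum_const, nsmul_eq_mul, mul_div_cancel₀]
    · exact hsum
    · exact_mod_cast hfam_ne.card_pos.ne'
  have hfam_pos : (0 : ℝ) < fam.card := by exact_mod_cast hfam_ne.card_pos
  refine ⟨K, ?_, ?_, ?_⟩
  · -- lower admissibility
    rw [hfam, Finset.mem_insert, Finset.mem_image] at hKfam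
    rcases hKfam with rfl | ⟨t, ht, rfl⟩
    · right; omega
    · rcases Nat.eq_zero_or_pos t with rfl | htpos
      · left; simp
      · right
        calc i = 1 * i := (one_mul i).symm
          _ ≤ t * i := Nat.mul_le_mul_right i htpos
          _ ≤ t * i + ρ := Nat.le_add_right _ _
  · -- middle / top admissibility
    rw [hfam, Finset.mem_insert, Finset.mem_image] at hKfam
    rcases hKfam with rfl | ⟨t, ht, rfl⟩
    · right; constructor <;> omega
    · left
      have ht' : t ≤ tstar := Nat.lt_succ_iff.mp (Finset.mem_range.mp ht)
      have h1 : t * i ≤ tstar * i := Nat.mul_le_mul_right i ht'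
      have h2 : tstar * i ≤ j - w - 1 := by rw [htstar]; exact Nat.div_mul_le_self _ _
      omega
  · rw [div_le_iff₀ hfam_pos] at hK
    calc (T.card : ℝ) ≤ ((T.filter (fun t => K ≤ t ∧ t < K + i + w)).card : ℝ) * fam.card := hK
      _ ≤ ((T.filter (fun t => K ≤ t ∧ t < K + i + w)).card : ℝ) * ((tstar + 2 : ℕ) : ℝ) := by
          gcongr
      _ = _ := by rw [mul_comm]


/-! ### The Green side: few digits, and no digits -/

/-- **Small digit sets** (Green 2012, Proposition 1, in the tree's proved form): if
`|μ̂(S)| ≤ K_G |S| e^{-c_G√n/|S|} 2ⁿ` for nonempty `S`, then for `1 ≤ |S|`, `|S| q₀ ≤ √n` and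
`n e^{-c_G q₀} 2^{n^{1/10}} (|K_G| + 1) < 1` one has `|walshSum μ S| < 2^{n - n^{1/10}}`.
[cite: Green2012, Proposition 1] -/
theorem green_small {n : ℕ} {cG KG : ℝ}
    (hG : ∀ S : Finset (Fin n), S.Nonempty →
      |walshSum (fun m => (μ m : ℤ)) S| / 2 ^ n ≤ KG * S.card * Real.exp (-(cG * Real.sqrt n / S.card)))
    (hcG : 0 < cG) {q₀ : ℕ} (S : Finset (Fin n)) (hS : S.Nonempty)
    (hSq : (S.card : ℝ) * q₀ ≤ Real.sqrt n)
    (hE5 : (n : ℝ) * Real.exp (-(cG * q₀)) * (2 : ℝ) ^ ((n : ℝ) ^ ((1 : ℝ) / 10)) * (|KG| + 1) < 1) :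
    |walshSum (fun m => (μ m : ℤ)) S| < (2 : ℝ) ^ ((n : ℝ) - (n : ℝ) ^ ((1 : ℝ) / 10)) := by
  have h := hG S hS
  have hk0 : (0 : ℝ) < S.card := by exact_mod_cast hS.card_pos
  have hkn : (S.card : ℝ) ≤ n := by
    have : S.card ≤ n := by simpa using S.card_le_univ
    exact_mod_cast this
  have h2n : (0 : ℝ) < 2 ^ n := by positivity
  rw [div_le_iff₀ h2n] at h
  -- `K_G ≥ 0` is forced unless the bound is vacuous; in any case `K_G ≤ |K_G| + 1`
  have hexp_le : Real.exp (-(cG * Real.sqrt n / S.card)) ≤ Real.exp (-(cG * q₀)) := by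
    rw [Real.exp_le_exp, neg_le_neg_iff]
    have h1 : (q₀ : ℝ) ≤ Real.sqrt n / S.card := by
      rw [le_div_iff₀ hk0]; linarith
    calc cG * q₀ ≤ cG * (Real.sqrt n / S.card) := by gcongr
      _ = cG * Real.sqrt n / S.card := by ring
  have hmain : |walshSum (fun m => (μ m : ℤ)) S| ≤ (|KG| + 1) * n * Real.exp (-(cG * q₀)) * 2 ^ n := by
    refine h.trans ?_
    have hK : KG ≤ |KG| + 1 := by linarith [le_abs_self KG]
    have h3 : KG * S.card * Real.exp (-(cG * Real.sqrt n / S.card)) ≤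
        (|KG| + 1) * S.card * Real.exp (-(cG * Real.sqrt n / S.card)) := by
      gcongr
    have h4 : (|KG| + 1) * S.card * Real.exp (-(cG * Real.sqrt n / S.card)) ≤
        (|KG| + 1) * n * Real.exp (-(cG * q₀)) := by
      gcongr
    nlinarith [h3, h4, h2n]
  have hy : (2 : ℝ) ^ ((n : ℝ) - (n : ℝ) ^ ((1 : ℝ) / 10)) = 2 ^ n / (2 : ℝ) ^ ((n : ℝ) ^ ((1 : ℝ) / 10)) := by
    rw [Real.rpow_sub (by norm_num), Real.rpow_natCast]
  rw [hy, lt_div_iff₀ (by positivity)]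
  calc |walshSum (fun m => (μ m : ℤ)) S| * (2 : ℝ) ^ ((n : ℝ) ^ ((1 : ℝ) / 10))
      ≤ (|KG| + 1) * n * Real.exp (-(cG * q₀)) * 2 ^ n * (2 : ℝ) ^ ((n : ℝ) ^ ((1 : ℝ) / 10)) := by
        gcongr
    _ = ((n : ℝ) * Real.exp (-(cG * q₀)) * (2 : ℝ) ^ ((n : ℝ) ^ ((1 : ℝ) / 10)) * (|KG| + 1)) * 2 ^ n := by ring
    _ < 1 * 2 ^ n := by gcongr
    _ = 2 ^ n := one_mul _

/-- **The empty digit set** (the constant coefficient): by Green's identity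
`μ̂(∅) + μ̂({0}) + μ̂({1}) + μ̂({0,1}) = 0` (tree: `Green2012.moebius_walshSum_empty_identity`), the
constant coefficient is controlled by three coefficients of weight `≤ 2`, so that
`|walshSum μ ∅| < 2^{n - n^{1/10}}` as soon as `4(|K_G|+1) e^{-c_G√n/2} 2^{n^{1/10}} < 1` (`n ≥ 2`).
[cite: Green2012, Proposition 1 and §2] -/
theorem green_empty {m : ℕ} {cG KG : ℝ}
    (hG : ∀ S : Finset (Fin (m + 2)), S.Nonempty →
      |walshSum (fun k => (μ k : ℤ)) S| / 2 ^ (m + 2) ≤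
        KG * S.card * Real.exp (-(cG * Real.sqrt (m + 2 : ℕ) / S.card)))
    (hcG : 0 < cG)
    (hE5' : 4 * (|KG| + 1) * Real.exp (-(cG * Real.sqrt (m + 2 : ℕ) / 2)) *
      (2 : ℝ) ^ (((m + 2 : ℕ) : ℝ) ^ ((1 : ℝ) / 10)) < 1) :
    |walshSum (fun k => (μ k : ℤ)) (∅ : Finset (Fin (m + 2)))| <
      (2 : ℝ) ^ (((m + 2 : ℕ) : ℝ) - ((m + 2 : ℕ) : ℝ) ^ ((1 : ℝ) / 10)) := by
  set n : ℕ := m + 2 with hn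
  have h2n : (0 : ℝ) < 2 ^ n := by positivity
  have hid := Green2012.moebius_walshSum_empty_identity (m := m)
  -- each of the three coefficients is `≤ 2 (|K_G|+1) e^{-c_G √n/2} 2^n`... in fact `≤ (|K_G|+1)·card·…`
  have hbound : ∀ S : Finset (Fin (m + 2)), S.Nonempty → S.card ≤ 2 →
      |walshSum (fun k => (μ k : ℤ)) S| ≤ (|KG| + 1) * S.card * Real.exp (-(cG * Real.sqrt n / 2)) * 2 ^ n := by
    intro S hS hS2
    have h := hG S hS
    rw [div_le_iff₀ h2n] at h
    have hk0 : (0 : ℝ) < S.card := by exact_mod_cast hS.card_pos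
    have hk2 : (S.card : ℝ) ≤ 2 := by exact_mod_cast hS2
    have hexp_le : Real.exp (-(cG * Real.sqrt n / S.card)) ≤ Real.exp (-(cG * Real.sqrt n / 2)) := by
      rw [Real.exp_le_exp, neg_le_neg_iff]
      apply div_le_div_of_nonneg_left (by positivity) hk0 hk2
    refine h.trans ?_
    have hK : KG ≤ |KG| + 1 := by linarith [le_abs_self KG]
    have h3 : KG * S.card * Real.exp (-(cG * Real.sqrt n / S.card)) ≤
        (|KG| + 1) * S.card * Real.exp (-(cG * Real.sqrt n / S.card)) := by gcongr
    have h4 : (|KG| + 1) * S.card * Real.exp (-(cG * Real.sqrt n / S.card)) ≤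
        (|KG| + 1) * S.card * Real.exp (-(cG * Real.sqrt n / 2)) := by gcongr
    nlinarith [h3, h4, h2n]
  have h0 := hbound ({0} : Finset (Fin (m + 2))) (by simp) (by simp)
  have h1 := hbound ({1} : Finset (Fin (m + 2))) (by simp) (by simp)
  have h01 := hbound ({0, 1} : Finset (Fin (m + 2))) (by simp) (by
    rw [Finset.card_insert_of_notMem (by simp)]; simp)
  simp only [Finset.card_singleton, Nat.cast_one, mul_one] at h0 h1
  rw [Finset.card_insert_of_notMem (by simp), Finset.card_singleton] at h01
  push_cast at h01
  have habs : |walshSum (fun k => (μ k : ℤ)) (∅ : Finset (Fin (m + 2)))| ≤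
      4 * (|KG| + 1) * Real.exp (-(cG * Real.sqrt n / 2)) * 2 ^ n := by
    have heq : walshSum (fun k => (μ k : ℤ)) (∅ : Finset (Fin (m + 2))) =
        -(walshSum (fun k => (μ k : ℤ)) ({0} : Finset (Fin (m + 2))) +
          walshSum (fun k => (μ k : ℤ)) ({1} : Finset (Fin (m + 2))) +
          walshSum (fun k => (μ k : ℤ)) ({0, 1} : Finset (Fin (m + 2)))) := by linarith
    rw [heq, abs_neg]
    have hA := abs_add_le (walshSum (fun k => (μ k : ℤ)) ({0} : Finset (Fin (m + 2))) +
        walshSum (fun k => (μ k : ℤ)) ({1} : Finset (Fin (m + 2))))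
      (walshSum (fun k => (μ k : ℤ)) ({0, 1} : Finset (Fin (m + 2))))
    have hB := abs_add_le (walshSum (fun k => (μ k : ℤ)) ({0} : Finset (Fin (m + 2))))
      (walshSum (fun k => (μ k : ℤ)) ({1} : Finset (Fin (m + 2))))
    have hpos : 0 ≤ (|KG| + 1) * Real.exp (-(cG * Real.sqrt n / 2)) * 2 ^ n := by positivity
    linarith [hA, hB, h0, h1, h01, hpos]
  have hy : (2 : ℝ) ^ ((n : ℝ) - (n : ℝ) ^ ((1 : ℝ) / 10)) = 2 ^ n / (2 : ℝ) ^ ((n : ℝ) ^ ((1 : ℝ) / 10)) := by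
    rw [Real.rpow_sub (by norm_num), Real.rpow_natCast]
  rw [hy, lt_div_iff₀ (by positivity)]
  calc |walshSum (fun k => (μ k : ℤ)) (∅ : Finset (Fin (m + 2)))| * (2 : ℝ) ^ ((n : ℝ) ^ ((1 : ℝ) / 10))
      ≤ 4 * (|KG| + 1) * Real.exp (-(cG * Real.sqrt n / 2)) * 2 ^ n * (2 : ℝ) ^ ((n : ℝ) ^ ((1 : ℝ) / 10)) := by
        gcongr
    _ = (4 * (|KG| + 1) * Real.exp (-(cG * Real.sqrt n / 2)) * (2 : ℝ) ^ ((n : ℝ) ^ ((1 : ℝ) / 10))) * 2 ^ n := by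
        ring
    _ < 1 * 2 ^ n := by gcongr
    _ = 2 ^ n := one_mul _

/-! ### A type-II box -/

/-- **A type-II box, from the type-II hypothesis.** [cite: Bourgain2013MoebiusWalsh, §2 (2.29)–(2.31), (2.33)–(2.34)] -/
theorem typeII_box {c C : ℝ} (hC : 0 ≤ C)
    (hII : ∀ (i j ρ g₀ K : ℕ) (T : Finset ℕ) (α β : ℕ → ℝ),
      i ≤ j → 1 ≤ g₀ → g₀ ≤ ρ → C * ρ ≤ i →
      (∀ t ∈ T, t < i + j + 2) →
      (K = 0 ∨ i ≤ K + ρ) →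
      (K + (ρ + g₀ + 1) + 1 ≤ j ∨ (j + 2 ≤ K + (ρ + g₀ + 1) ∧ K + ρ ≤ j)) →
      (∀ a, |α a| ≤ 1) → (∀ b, |β b| ≤ 1) →
      |boxSum T i j α β| ≤ 2 ^ (i + j) * ((i : ℝ) + j + 2) ^ C *
        ((2 : ℝ) ^ (-(c * g₀)) + (2 : ℝ) ^ (C * ρ - c * i) +
          (2 : ℝ) ^ (C * ρ - c * ((T.filter (fun t => K ≤ t ∧ t < K + i + (ρ + g₀ + 1))).card : ℝ))))
    {n i j q ρ : ℕ} (T : Finset ℕ)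
    (hT : ∀ t ∈ T, t < i + j + 2) (hij : i ≤ j) (hi8 : n / 8 ≤ i) (hijn : i + j < n) (hn : 16 ≤ n)
    (hq : 1 ≤ q) (hpow : (n : ℝ) + 1 ≤ 2 ^ q) (hρ : 1 ≤ ρ) (hw : 2 * ρ + 2 ≤ n / 8)
    (hCρ : C * ρ ≤ ((n / 8 : ℕ) : ℝ)) (h1 : (C + 7) * q ≤ c * ρ)
    (h2 : C * ρ + (C + 7) * q ≤ c * ((n / 8 : ℕ) : ℝ))
    (h3 : C * ρ + (C + 7) * q ≤ c * ((T.card : ℝ) / 24))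
    (α β : ℕ → ℝ) (hα : ∀ a, |α a| ≤ 1) (hβ : ∀ b, |β b| ≤ 1) :
    |boxSum T i j α β| ≤ 2 ^ (i + j) * (2 : ℝ) ^ (-(5 * (q : ℝ))) := by
  -- positivity of `c`
  have hq1 : (1 : ℝ) ≤ q := by exact_mod_cast hq
  have hρ1 : (1 : ℝ) ≤ ρ := by exact_mod_cast hρ
  have hc : 0 < c := by
    by_contra hcn
    push Not at hcn
    have : (C + 7) * (q : ℝ) ≤ 0 := h1.trans (mul_nonpos_of_nonpos_of_nonneg hcn (by positivity))
    nlinarith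
  have hu2 : 2 ≤ n / 8 := by omega
  have hi1 : 1 ≤ i := by omega
  have hjw : 2 * ρ + 1 + 1 ≤ j := by omega
  obtain ⟨K, hK1, hK2, hdens⟩ := exists_dense_window T hi1 hij hρ hjw hT
  -- the family has at most `24` windows
  have hfam : (j - (2 * ρ + 1) - 1) / i + 2 ≤ 24 := by
    have ha : (j - (2 * ρ + 1) - 1) / i ≤ n / i := Nat.div_le_div_right (by omega)
    have hb : n / i ≤ n / (n / 8) := Nat.div_le_div_left hi8 (by omega)
    have hc' : n / (n / 8) < 12 := by
      rw [Nat.div_lt_iff_lt_mul (by omega)]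
      have := Nat.lt_div_mul_add (a := n) (b := 8) (by norm_num)
      omega
    omega
  set d : ℝ := ((T.filter (fun t => K ≤ t ∧ t < K + i + (2 * ρ + 1))).card : ℝ) with hd
  have hd0 : 0 ≤ d := Nat.cast_nonneg _
  have hcard : (T.card : ℝ) ≤ 24 * d := by
    refine hdens.trans ?_
    gcongr
    exact_mod_cast hfam
  have h3' : C * ρ + (C + 7) * q ≤ c * d := by
    refine h3.trans ?_
    have : (T.card : ℝ) / 24 ≤ d := by rw [div_le_iff₀ (by norm_num)]; linarith
    exact mul_le_mul_of_nonneg_left this hc.le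
  have hi8' : ((n / 8 : ℕ) : ℝ) ≤ i := by exact_mod_cast hi8
  have hCi : C * ρ ≤ i := hCρ.trans hi8'
  have h2' : C * ρ + (C + 7) * q ≤ c * i := h2.trans (mul_le_mul_of_nonneg_left hi8' hc.le)
  -- apply the hypothesis with `g₀ = ρ`
  have hK2' : K + (ρ + ρ + 1) + 1 ≤ j ∨ (j + 2 ≤ K + (ρ + ρ + 1) ∧ K + ρ ≤ j) := by
    rw [← two_mul]; exact hK2
  have hbox := hII i j ρ ρ K T α β hij hρ le_rfl hCi hT hK1 hK2' hα hβ
  rw [← two_mul, ← hd] at hbox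
  refine hbox.trans ?_
  rw [mul_assoc]
  refine mul_le_mul_of_nonneg_left ?_ (by positivity)
  have hL1 : (1 : ℝ) ≤ (i : ℝ) + j + 2 := by
    have : (0 : ℝ) ≤ (i : ℝ) + j := by positivity
    linarith
  have hL : (i : ℝ) + j + 2 ≤ (2 : ℝ) ^ q := by
    have : ((i + j : ℕ) : ℝ) + 1 ≤ n := by exact_mod_cast hijn
    push_cast at this
    linarith
  exact three_terms_le hC hq hL1 hL h1 h2' h3'


/-! ### A type-I box: the final Cauchy–Schwarz step and the two analytic regimes -/

/-- From `∑_a |∑_b w_T(ab)| ≤ 2^{i+j} G` with `2(n+1)³ G ≤ 2^{-4q}` to `|box_I| ≤ 2^{i+j} 2^{-2q}`.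
[folklore] -/
theorem typeI_box_of_G (T : Finset ℕ) {i j n q u : ℕ} {G : ℝ}
    (hF : ∑ a ∈ dyBlock i, |∑ b ∈ dyBlock j, natWalsh T (a * b)| ≤ 2 ^ (i + j) * G)
    (hG : 2 * ((n : ℝ) + 1) ^ 3 * G ≤ (2 : ℝ) ^ (-(4 * (q : ℝ)))) (hin : i < n) :
    |boxSum T i j (typeICoeff u) (fun _ => 1)| ≤ 2 ^ (i + j) * (2 : ℝ) ^ (-(2 * (q : ℝ))) := by
  have hlog : 1 + Real.log ((2 : ℝ) ^ (i + 1)) ≤ n + 1 := by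
    rw [Real.log_pow]
    have h2 : Real.log 2 ≤ 1 := by have := Real.log_two_lt_d9; linarith
    have h3 : ((i + 1 : ℕ) : ℝ) * Real.log 2 ≤ (i + 1 : ℕ) := by
      have := mul_le_mul_of_nonneg_left h2 (Nat.cast_nonneg (i + 1)); simpa using this
    have h4 : ((i + 1 : ℕ) : ℝ) ≤ n := by exact_mod_cast hin
    linarith
  refine (abs_boxSum_typeI_le T i j u hF).trans ?_
  refine (cs_numeric le_rfl hlog).trans ?_
  refine mul_le_mul_of_nonneg_left ?_ (by positivity)
  calc Real.sqrt (2 * ((n : ℝ) + 1) ^ 3 * G) ≤ Real.sqrt ((2 : ℝ) ^ (-(4 * (q : ℝ)))) :=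
        Real.sqrt_le_sqrt hG
    _ = (2 : ℝ) ^ (-(2 * (q : ℝ))) := by
        rw [Real.sqrt_eq_rpow, ← Real.rpow_mul (by norm_num)]; ring_nf

/-- `c₂ = walshSupExponent < 1`. [folklore] -/
theorem walshSupExponent_lt_one : walshSupExponent < 1 := by
  unfold walshSupExponent
  have h : Real.logb 2 (27 / 16) < 1 := by
    rw [Real.logb_lt_iff_lt_rpow one_lt_two (by norm_num)]; norm_num
  linarith

/-- **The crude regime, numerically**: if `i ≤ c₂ m/2` (`m = |T|`, `T ⊆ [0, i+j+2)`, `i + j < n`), then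
`∑_a |∑_b w_T(ab)| ≤ 2^{i+j} · 12(n+2) 2^{-c₂m/2}`. [cite: Bourgain2013MoebiusWalsh, §3 (3.3)] -/
theorem typeI_crude_regime (T : Finset ℕ) {i j n : ℕ} (hT : ∀ t ∈ T, t < i + j + 2) (hijn : i + j < n)
    (hA : (i : ℝ) ≤ walshSupExponent * T.card / 2) :
    ∑ a ∈ dyBlock i, |∑ b ∈ dyBlock j, natWalsh T (a * b)| ≤
      2 ^ (i + j) * (12 * ((n : ℝ) + 2) * (2 : ℝ) ^ (-(walshSupExponent * T.card / 2))) := by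
  set c₂ := walshSupExponent with hc₂
  set m : ℝ := (T.card : ℝ) with hm
  have h2 : (0 : ℝ) < 2 := by norm_num
  refine (typeI_crude T hT i j).trans ?_
  -- rewrite the bracket as `2^{i+j} (2(i+1) + 4·2^i (1 + log 2^{i+j+2}))`
  have hlogΛ : 1 + Real.log ((2 : ℝ) ^ (i + j + 2)) ≤ n + 2 := by
    rw [Real.log_pow]
    have hl : Real.log 2 ≤ 1 := by have := Real.log_two_lt_d9; linarith
    have h3 : ((i + j + 2 : ℕ) : ℝ) * Real.log 2 ≤ (i + j + 2 : ℕ) := by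
      have := mul_le_mul_of_nonneg_left hl (Nat.cast_nonneg (i + j + 2)); simpa using this
    have h4 : ((i + j + 2 : ℕ) : ℝ) ≤ n + 1 := by exact_mod_cast (show i + j + 2 ≤ n + 1 by omega)
    linarith
  have hlog0 : 0 ≤ 1 + Real.log ((2 : ℝ) ^ (i + j + 2)) := by
    have := Real.log_nonneg (one_le_pow₀ (M₀ := ℝ) one_le_two (n := i + j + 2)); linarith
  have hi1 : (1 : ℝ) ≤ 2 ^ i := one_le_pow₀ one_le_two
  have hin : ((i : ℝ) + 1) ≤ n + 1 := by
    have : (i : ℝ) ≤ n := by exact_mod_cast (show i ≤ n by omega)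
    linarith
  -- `2^{-c₂ m} 2^i ≤ 2^{-c₂ m/2}`
  have hkey : (2 : ℝ) ^ (-(c₂ * m)) * 2 ^ i ≤ (2 : ℝ) ^ (-(c₂ * m / 2)) := by
    have h1 : (2 : ℝ) ^ i = (2 : ℝ) ^ (i : ℝ) := (Real.rpow_natCast 2 i).symm
    rw [h1, ← Real.rpow_add h2]
    exact Real.rpow_le_rpow_of_exponent_le one_le_two (by linarith)
  have hbr : 2 * (2 : ℝ) ^ j * (((i : ℝ) + 1) * 2 ^ i) + 2 ^ i * (2 ^ (i + j + 2) * (1 + Real.log (2 ^ (i + j + 2))))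
      ≤ 2 ^ (i + j) * (2 ^ i * (6 * ((n : ℝ) + 2))) := by
    have e1 : 2 * (2 : ℝ) ^ j * (((i : ℝ) + 1) * 2 ^ i) = 2 ^ (i + j) * (2 * ((i : ℝ) + 1)) := by
      rw [pow_add]; ring
    have e2 : (2 : ℝ) ^ i * (2 ^ (i + j + 2) * (1 + Real.log (2 ^ (i + j + 2)))) =
        2 ^ (i + j) * (2 ^ i * (4 * (1 + Real.log (2 ^ (i + j + 2))))) := by
      rw [pow_add, pow_add]; ring
    rw [e1, e2, ← mul_add]
    refine mul_le_mul_of_nonneg_left ?_ (by positivity)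
    have h5 : 2 * ((i : ℝ) + 1) ≤ 2 ^ i * (2 * ((i : ℝ) + 1)) := by
      have := mul_le_mul_of_nonneg_right hi1 (show 0 ≤ 2 * ((i : ℝ) + 1) by positivity); linarith
    have h6 : (2 : ℝ) ^ i * (2 * ((i : ℝ) + 1)) + 2 ^ i * (4 * (1 + Real.log (2 ^ (i + j + 2)))) ≤
        2 ^ i * (6 * ((n : ℝ) + 2)) := by
      rw [← mul_add]
      refine mul_le_mul_of_nonneg_left ?_ (by positivity)
      linarith
    linarith
  calc 2 * (2 : ℝ) ^ (-(c₂ * m)) *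
        (2 * 2 ^ j * (((i : ℝ) + 1) * 2 ^ i) + 2 ^ i * (2 ^ (i + j + 2) * (1 + Real.log (2 ^ (i + j + 2)))))
      ≤ 2 * (2 : ℝ) ^ (-(c₂ * m)) * (2 ^ (i + j) * (2 ^ i * (6 * ((n : ℝ) + 2)))) := by
        gcongr
    _ = 2 ^ (i + j) * (12 * ((n : ℝ) + 2) * ((2 : ℝ) ^ (-(c₂ * m)) * 2 ^ i)) := by ring
    _ ≤ 2 ^ (i + j) * (12 * ((n : ℝ) + 2) * (2 : ℝ) ^ (-(c₂ * m / 2))) := by gcongr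

/-- **The refined regime, numerically**: with `θ = |T ∩ [j-i, i+j+2)|`, if
`θ (1 + log(2(i+j+2))/log 2) ≤ c₂ m/4` then `∑_a |∑_b w_T(ab)| ≤ 2^{i+j} · 12(n+2) 2^{-c₂m/2}`.
[cite: Bourgain2013MoebiusWalsh, §3 (3.9)] -/
theorem typeI_refined_regime (T : Finset ℕ) {i j n : ℕ} (hT : ∀ t ∈ T, t < i + j + 2) (hij : i ≤ j)
    (hijn : i + j < n)
    (hB : ((T.filter (fun t => ¬ t < j - i)).card : ℝ) *
      (1 + Real.log (2 * ((i + j + 2 : ℕ) : ℝ)) / Real.log 2) ≤ walshSupExponent * T.card / 4) :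
    ∑ a ∈ dyBlock i, |∑ b ∈ dyBlock j, natWalsh T (a * b)| ≤
      2 ^ (i + j) * (12 * ((n : ℝ) + 2) * (2 : ℝ) ^ (-(walshSupExponent * T.card / 2))) := by
  set c₂ := walshSupExponent with hc₂
  set m : ℝ := (T.card : ℝ) with hm
  set θ : ℕ := (T.filter (fun t => ¬ t < j - i)).card with hθ
  set Λ : ℕ := i + j + 2 with hΛ
  have h2 : (0 : ℝ) < 2 := by norm_num
  have hl2 : 0 < Real.log 2 := Real.log_pos one_lt_two
  have hc₂1 : c₂ < 1 := walshSupExponent_lt_one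
  have hc₂0 : 0 < c₂ := walshSupExponent_pos
  have hΛ1 : (1 : ℝ) ≤ Λ := by
    have : 1 ≤ Λ := by omega
    exact_mod_cast this
  have hθm : ((T.filter (· < j - i)).card : ℝ) = m - θ := by
    have h := Finset.card_filter_add_card_filter_not (s := T) (fun t => t < j - i)
    have h' : ((T.filter (· < j - i)).card : ℝ) + θ = m := by rw [hm, ← h]; push_cast; rfl
    linarith
  refine (typeI_refined T hT hij).trans ?_
  rw [hθm]
  -- `(2Λ)^θ = 2^{θ log(2Λ)/log 2}`
  have h2Λ : (0 : ℝ) < 2 * Λ := by positivity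
  have hpowθ : (2 * (Λ : ℝ)) ^ θ = (2 : ℝ) ^ ((θ : ℝ) * (Real.log (2 * Λ) / Real.log 2)) := by
    rw [← Real.rpow_natCast, Real.rpow_def_of_pos h2Λ, Real.rpow_def_of_pos h2, mul_comm (Real.log (2 * Λ))]
    congr 1
    field_simp
  -- the exponent bookkeeping
  have hlog2Λ0 : 0 ≤ Real.log (2 * Λ) := Real.log_nonneg (by linarith)
  have hexp : -(c₂ * (m - θ)) + (θ : ℝ) * (Real.log (2 * Λ) / Real.log 2) ≤ -(3 * c₂ * m / 4) := by
    have hθ0 : (0 : ℝ) ≤ θ := Nat.cast_nonneg _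
    have h1 : c₂ * θ ≤ θ := by nlinarith
    have h3 : (θ : ℝ) * (1 + Real.log (2 * Λ) / Real.log 2) ≤ c₂ * m / 4 := hB
    have h4 : (θ : ℝ) * (1 + Real.log (2 * Λ) / Real.log 2) = θ + θ * (Real.log (2 * Λ) / Real.log 2) := by
      ring
    linarith
  have hkey : 2 * (2 : ℝ) ^ (-(c₂ * (m - θ))) * (2 * (Λ : ℝ)) ^ θ ≤ 2 * (2 : ℝ) ^ (-(c₂ * m / 2)) := by
    rw [hpowθ, mul_assoc, ← Real.rpow_add h2]
    refine mul_le_mul_of_nonneg_left ?_ (by norm_num)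
    refine Real.rpow_le_rpow_of_exponent_le one_le_two ?_
    have hm0 : 0 ≤ m := Nat.cast_nonneg _
    nlinarith
  -- the bracket
  have hlogd0 : 0 ≤ 1 + Real.log ((2 : ℝ) ^ (j - i)) := by
    have := Real.log_nonneg (one_le_pow₀ (M₀ := ℝ) one_le_two (n := j - i)); linarith
  have hbr0 : 0 ≤ (2 : ℝ) ^ j * (2 * (((i : ℝ) + 1) * 2 ^ i) + (1 + Real.log (2 ^ (j - i)))) :=
    mul_nonneg (by positivity) (add_nonneg (by positivity) hlogd0)
  have hbr : (2 : ℝ) ^ j * (2 * (((i : ℝ) + 1) * 2 ^ i) + (1 + Real.log (2 ^ (j - i)))) ≤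
      2 ^ (i + j) * (6 * ((n : ℝ) + 2)) := by
    have hlogd : 1 + Real.log ((2 : ℝ) ^ (j - i)) ≤ n + 2 := by
      rw [Real.log_pow]
      have hl : Real.log 2 ≤ 1 := by have := Real.log_two_lt_d9; linarith
      have h3 : ((j - i : ℕ) : ℝ) * Real.log 2 ≤ (j - i : ℕ) := by
        have := mul_le_mul_of_nonneg_left hl (Nat.cast_nonneg (j - i)); simpa using this
      have h4 : ((j - i : ℕ) : ℝ) ≤ n + 1 := by exact_mod_cast (show j - i ≤ n + 1 by omega)
      linarith
    have hi1 : (1 : ℝ) ≤ 2 ^ i := one_le_pow₀ one_le_two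
    have hin : ((i : ℝ) + 1) ≤ n + 1 := by
      have : (i : ℝ) ≤ n := by exact_mod_cast (show i ≤ n by omega)
      linarith
    rw [pow_add]
    have h5 : 1 + Real.log ((2 : ℝ) ^ (j - i)) ≤ 2 ^ i * ((n : ℝ) + 2) := by
      have := mul_le_mul hi1 hlogd hlogd0 (by positivity); linarith
    have h6 : 2 * (((i : ℝ) + 1) * 2 ^ i) ≤ 2 ^ i * (2 * ((n : ℝ) + 1)) := by nlinarith
    nlinarith [pow_pos h2 j, pow_pos h2 i]
  calc 2 * (2 : ℝ) ^ (-(c₂ * (m - θ))) * (2 * (Λ : ℝ)) ^ θ *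
        (2 ^ j * (2 * (((i : ℝ) + 1) * 2 ^ i) + (1 + Real.log (2 ^ (j - i)))))
      ≤ 2 * (2 : ℝ) ^ (-(c₂ * m / 2)) * (2 ^ (i + j) * (6 * ((n : ℝ) + 2))) :=
        mul_le_mul hkey hbr hbr0 (by positivity)
    _ = 2 ^ (i + j) * (12 * ((n : ℝ) + 2) * (2 : ℝ) ^ (-(c₂ * m / 2))) := by ring

/-- **The top block is covered by two windows.** For `i ≤ j`, `1 ≤ ρ`, `T ⊆ [0, i+j+2)`, the elements
`≥ j - i` of `T` lie in `[j-i, j+2ρ+1) ∪ [j-ρ, j-ρ+i+2ρ+1)`. [folklore] -/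
theorem card_top_le_two_windows (T : Finset ℕ) {i j ρ : ℕ} (hij : i ≤ j) (hρ : 1 ≤ ρ) (hρj : ρ ≤ j)
    (hT : ∀ t ∈ T, t < i + j + 2) :
    (T.filter (fun t => ¬ t < j - i)).card ≤
      (T.filter (fun t => j - i ≤ t ∧ t < (j - i) + i + (2 * ρ + 1))).card +
        (T.filter (fun t => j - ρ ≤ t ∧ t < (j - ρ) + i + (2 * ρ + 1))).card := by
  classical
  calc (T.filter (fun t => ¬ t < j - i)).card
      ≤ (T.filter (fun t => j - i ≤ t ∧ t < (j - i) + i + (2 * ρ + 1)) ∪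
          T.filter (fun t => j - ρ ≤ t ∧ t < (j - ρ) + i + (2 * ρ + 1))).card := by
        refine Finset.card_le_card fun t ht => ?_
        rw [Finset.mem_filter] at ht
        have htΛ := hT t ht.1
        rw [Finset.mem_union, Finset.mem_filter, Finset.mem_filter]
        by_cases h : t < (j - i) + i + (2 * ρ + 1)
        · exact Or.inl ⟨ht.1, by omega, h⟩
        · exact Or.inr ⟨ht.1, by omega, by omega⟩
    _ ≤ _ := Finset.card_union_le _ _


/-! ### A type-I box: the trichotomy -/

set_option maxHeartbeats 800000 in
-- three regimes with shared bookkeeping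
/-- **A type-I box** (`a ≤ u²` short, `b` long): crude regime, refined regime, or — when the top
`2i + 2` digits carry many elements of `T` — a type-II sum through the signs `ε_a` and Cauchy–Schwarz.
[cite: Bourgain2013MoebiusWalsh, §3 (3.1)–(3.9) and (2.35)] -/
theorem typeI_box {c C : ℝ} (hC : 0 ≤ C)
    (hII : ∀ (i j ρ g₀ K : ℕ) (T : Finset ℕ) (α β : ℕ → ℝ),
      i ≤ j → 1 ≤ g₀ → g₀ ≤ ρ → C * ρ ≤ i →
      (∀ t ∈ T, t < i + j + 2) →
      (K = 0 ∨ i ≤ K + ρ) →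
      (K + (ρ + g₀ + 1) + 1 ≤ j ∨ (j + 2 ≤ K + (ρ + g₀ + 1) ∧ K + ρ ≤ j)) →
      (∀ a, |α a| ≤ 1) → (∀ b, |β b| ≤ 1) →
      |boxSum T i j α β| ≤ 2 ^ (i + j) * ((i : ℝ) + j + 2) ^ C *
        ((2 : ℝ) ^ (-(c * g₀)) + (2 : ℝ) ^ (C * ρ - c * i) +
          (2 : ℝ) ^ (C * ρ - c * ((T.filter (fun t => K ≤ t ∧ t < K + i + (ρ + g₀ + 1))).card : ℝ))))
    {n i j q ρ : ℕ} {M₀ : ℝ} (T : Finset ℕ)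
    (hT : ∀ t ∈ T, t < i + j + 2) (hij : i ≤ j) (h2i : 2 * i ≤ j) (hijn : i + j < n)
    (hq : 1 ≤ q) (hpow : (n : ℝ) + 1 ≤ 2 ^ q) (hpow3 : 2 * ((n : ℝ) + 1) ^ 3 ≤ 2 ^ q) (hρ : 1 ≤ ρ)
    (hM₀T : M₀ ≤ T.card)
    (hE9 : 24 * ((n : ℝ) + 2) ^ 4 * (2 : ℝ) ^ (-(walshSupExponent * M₀ / 2)) ≤ (2 : ℝ) ^ (-(4 * (q : ℝ))))
    (hE11b : 2 * (ρ : ℝ) + 2 ≤ walshSupExponent * M₀ / 2)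
    (hE6'' : C * ρ ≤ walshSupExponent * M₀ / 2)
    (h1 : (C + 7) * q ≤ c * ρ)
    (hE8 : C * ρ + (C + 7) * q ≤
      c * (walshSupExponent * M₀ / (8 * (2 + Real.log ((n : ℝ) + 1) / Real.log 2))))
    (u : ℕ) :
    |boxSum T i j (typeICoeff u) (fun _ => 1)| ≤ 2 ^ (i + j) * (2 : ℝ) ^ (-(2 * (q : ℝ))) := by
  set c₂ := walshSupExponent with hc₂
  set m : ℝ := (T.card : ℝ) with hm
  set Λ : ℕ := i + j + 2 with hΛ
  have h2 : (0 : ℝ) < 2 := by norm_num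
  have hl2 : 0 < Real.log 2 := Real.log_pos one_lt_two
  have hc₂0 : 0 < c₂ := walshSupExponent_pos
  have hq1 : (1 : ℝ) ≤ q := by exact_mod_cast hq
  have hρ1 : (1 : ℝ) ≤ ρ := by exact_mod_cast hρ
  have hc : 0 < c := by
    by_contra hcn
    push Not at hcn
    have : (C + 7) * (q : ℝ) ≤ 0 := h1.trans (mul_nonpos_of_nonpos_of_nonneg hcn (by positivity))
    nlinarith
  have hin : i < n := by omega
  have hn1 : (1 : ℝ) ≤ (n : ℝ) + 1 := by linarith [(Nat.cast_nonneg n : (0 : ℝ) ≤ n)]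
  have hM₀0 : 0 < M₀ := by nlinarith
  have hM₀m : c₂ * M₀ / 2 ≤ c₂ * m / 2 := by gcongr
  -- the bound `G₁` of the two analytic regimes
  have hG₁ : 2 * ((n : ℝ) + 1) ^ 3 * (12 * ((n : ℝ) + 2) * (2 : ℝ) ^ (-(c₂ * m / 2))) ≤
      (2 : ℝ) ^ (-(4 * (q : ℝ))) := by
    refine le_trans ?_ hE9
    have hmono : (2 : ℝ) ^ (-(c₂ * m / 2)) ≤ (2 : ℝ) ^ (-(c₂ * M₀ / 2)) :=
      Real.rpow_le_rpow_of_exponent_le one_le_two (by linarith)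
    have hpoly : 2 * ((n : ℝ) + 1) ^ 3 * (12 * ((n : ℝ) + 2)) ≤ 24 * ((n : ℝ) + 2) ^ 4 := by
      have hn0 : (0 : ℝ) ≤ n := Nat.cast_nonneg n
      have h3 : ((n : ℝ) + 1) ^ 3 ≤ ((n : ℝ) + 2) ^ 3 := by gcongr; linarith
      nlinarith [h3]
    calc 2 * ((n : ℝ) + 1) ^ 3 * (12 * ((n : ℝ) + 2) * (2 : ℝ) ^ (-(c₂ * m / 2)))
        = (2 * ((n : ℝ) + 1) ^ 3 * (12 * ((n : ℝ) + 2))) * (2 : ℝ) ^ (-(c₂ * m / 2)) := by ring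
      _ ≤ (24 * ((n : ℝ) + 2) ^ 4) * (2 : ℝ) ^ (-(c₂ * M₀ / 2)) :=
          mul_le_mul hpoly hmono (by positivity) (by positivity)
      _ = 24 * ((n : ℝ) + 2) ^ 4 * (2 : ℝ) ^ (-(c₂ * M₀ / 2)) := by ring
  by_cases hA : (i : ℝ) ≤ c₂ * m / 2
  · exact typeI_box_of_G T (typeI_crude_regime T hT hijn hA) hG₁ hin
  by_cases hB : ((T.filter (fun t => ¬ t < j - i)).card : ℝ) *
      (1 + Real.log (2 * ((i + j + 2 : ℕ) : ℝ)) / Real.log 2) ≤ c₂ * m / 4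
  · exact typeI_box_of_G T (typeI_refined_regime T hT hij hijn hB) hG₁ hin
  -- the dense-top regime: a type-II sum
  have hA' := not_le.mp hA
  have hB' := not_le.mp hB
  set θ : ℕ := (T.filter (fun t => ¬ t < j - i)).card with hθ
  have hi_real : c₂ * M₀ / 2 < i := lt_of_le_of_lt hM₀m hA'
  have hρi : 2 * ρ + 2 ≤ i := by
    have : ((2 * ρ + 2 : ℕ) : ℝ) ≤ i := by push_cast; linarith
    exact_mod_cast this
  have hρj : ρ ≤ j := by omega
  have hCi : C * ρ ≤ i := by linarith
  -- the denominators
  set den : ℝ := 2 + Real.log ((n : ℝ) + 1) / Real.log 2 with hden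
  set den' : ℝ := 1 + Real.log (2 * ((i + j + 2 : ℕ) : ℝ)) / Real.log 2 with hden'
  have hlogn1 : 0 ≤ Real.log ((n : ℝ) + 1) := Real.log_nonneg hn1
  have hden2 : 2 ≤ den := by
    have : 0 ≤ Real.log ((n : ℝ) + 1) / Real.log 2 := by positivity
    linarith
  have hden'le : den' ≤ den := by
    have hΛpos : (0 : ℝ) < ((i + j + 2 : ℕ) : ℝ) := by positivity
    have hlogΛ : Real.log (2 * ((i + j + 2 : ℕ) : ℝ)) = Real.log 2 + Real.log ((i + j + 2 : ℕ) : ℝ) :=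
      Real.log_mul (by norm_num) hΛpos.ne'
    have hle : Real.log ((i + j + 2 : ℕ) : ℝ) ≤ Real.log ((n : ℝ) + 1) :=
      Real.log_le_log hΛpos (by exact_mod_cast (show i + j + 2 ≤ n + 1 by omega))
    rw [hden', hden, hlogΛ, add_div, div_self hl2.ne']
    have := div_le_div_of_nonneg_right hle hl2.le
    linarith
  have hden'pos : 0 < den' := by
    have hΛ1 : (1 : ℝ) ≤ 2 * ((i + j + 2 : ℕ) : ℝ) := by
      have : (1 : ℝ) ≤ ((i + j + 2 : ℕ) : ℝ) := by exact_mod_cast (show 1 ≤ i + j + 2 by omega)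
      linarith
    have : 0 ≤ Real.log (2 * ((i + j + 2 : ℕ) : ℝ)) / Real.log 2 :=
      div_nonneg (Real.log_nonneg hΛ1) hl2.le
    rw [hden']; linarith
  -- `c₂ M₀ / (8 den) < θ / 2`
  have hθ_lower : c₂ * M₀ / (8 * den) < (θ : ℝ) / 2 := by
    have h3 : c₂ * M₀ / 4 < (θ : ℝ) * den' := by linarith [hB', hM₀m]
    have h4 : c₂ * M₀ / (8 * den) ≤ c₂ * M₀ / (8 * den') := by
      apply div_le_div_of_nonneg_left (by positivity) (by positivity)
      gcongr
    have h5 : c₂ * M₀ / (8 * den') < (θ : ℝ) / 2 := by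
      rw [div_lt_div_iff₀ (by positivity) (by norm_num)]
      nlinarith
    linarith
  -- `C ρ + (C+7) q ≤ c i`
  have h2' : C * ρ + (C + 7) * q ≤ c * i := by
    refine hE8.trans (mul_le_mul_of_nonneg_left ?_ hc.le)
    have h6 : c₂ * M₀ / (8 * den) ≤ c₂ * M₀ / 16 := by
      apply div_le_div_of_nonneg_left (by positivity) (by norm_num)
      linarith
    linarith
  -- the two candidate windows and the key step
  have key : ∀ K : ℕ, (K = 0 ∨ i ≤ K + ρ) →
      (K + (ρ + ρ + 1) + 1 ≤ j ∨ (j + 2 ≤ K + (ρ + ρ + 1) ∧ K + ρ ≤ j)) →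
      (θ : ℝ) ≤ 2 * ((T.filter (fun t => K ≤ t ∧ t < K + i + (ρ + ρ + 1))).card : ℝ) →
      |boxSum T i j (typeICoeff u) (fun _ => 1)| ≤ 2 ^ (i + j) * (2 : ℝ) ^ (-(2 * (q : ℝ))) := by
    intro K hK1 hK2 hKd
    set d : ℝ := ((T.filter (fun t => K ≤ t ∧ t < K + i + (ρ + ρ + 1))).card : ℝ) with hd
    have h3' : C * ρ + (C + 7) * q ≤ c * d := by
      refine hE8.trans (mul_le_mul_of_nonneg_left ?_ hc.le)
      linarith
    -- the type-II bound for the signed sum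
    have hbox := hII i j ρ ρ K T
      (fun a => if 0 ≤ ∑ b ∈ dyBlock j, natWalsh T (a * b) then 1 else -1) (fun _ => 1)
      hij hρ le_rfl hCi hT hK1 hK2 (fun a => abs_sign_le_one T j a) (fun _ => by simp)
    rw [← sum_abs_eq_boxSum_sign, ← hd] at hbox
    have hL1 : (1 : ℝ) ≤ (i : ℝ) + j + 2 := by
      have : (0 : ℝ) ≤ (i : ℝ) + j := by positivity
      linarith
    have hL : (i : ℝ) + j + 2 ≤ (2 : ℝ) ^ q := by
      have : ((i + j : ℕ) : ℝ) + 1 ≤ n := by exact_mod_cast hijn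
      push_cast at this
      linarith
    have hthree := three_terms_le (d := d) hC hq hL1 hL h1 h2' h3'
    have hF : ∑ a ∈ dyBlock i, |∑ b ∈ dyBlock j, natWalsh T (a * b)| ≤
        2 ^ (i + j) * (2 : ℝ) ^ (-(5 * (q : ℝ))) := by
      refine (le_abs_self _).trans (hbox.trans ?_)
      rw [mul_assoc]
      exact mul_le_mul_of_nonneg_left hthree (by positivity)
    have hG₂ : 2 * ((n : ℝ) + 1) ^ 3 * (2 : ℝ) ^ (-(5 * (q : ℝ))) ≤ (2 : ℝ) ^ (-(4 * (q : ℝ))) := by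
      have e : (2 : ℝ) ^ (-(4 * (q : ℝ))) = (2 : ℝ) ^ q * (2 : ℝ) ^ (-(5 * (q : ℝ))) := by
        rw [← Real.rpow_natCast, ← Real.rpow_add h2]; ring_nf
      rw [e]
      exact mul_le_mul_of_nonneg_right hpow3 (by positivity)
    exact typeI_box_of_G T hF hG₂ hin
  -- the top block splits between the two windows
  have htop := card_top_le_two_windows T hij hρ hρj hT
  have e2ρ : ρ + ρ + 1 = 2 * ρ + 1 := by ring
  rcases le_total ((T.filter (fun t => j - ρ ≤ t ∧ t < (j - ρ) + i + (2 * ρ + 1))).card)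
      ((T.filter (fun t => j - i ≤ t ∧ t < (j - i) + i + (2 * ρ + 1))).card) with hle | hle
  · -- the middle window `K = j - i`
    refine key (j - i) (Or.inr (by omega)) (Or.inl (by omega)) ?_
    rw [e2ρ]
    have : θ ≤ 2 * (T.filter (fun t => j - i ≤ t ∧ t < (j - i) + i + (2 * ρ + 1))).card := by omega
    exact_mod_cast this
  · -- the top window `K = j - ρ`
    refine key (j - ρ) (Or.inr (by omega)) (Or.inr ⟨by omega, by omega⟩) ?_
    rw [e2ρ]
    have : θ ≤ 2 * (T.filter (fun t => j - ρ ≤ t ∧ t < (j - ρ) + i + (2 * ρ + 1))).card := by omega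
    exact_mod_cast this


/-! ### Digit sets of the Vaughan reduction -/

/-- Cutting a set of digits `< n` at height `L ≤ n` loses at most `n - L` elements. [folklore] -/
theorem card_le_card_filter_lt_add (S : Finset ℕ) {n L : ℕ} (hS : ∀ t ∈ S, t < n) :
    S.card ≤ (S.filter (· < L)).card + (n - L) := by
  classical
  rw [← Finset.card_filter_add_card_filter_not (s := S) (fun t => t < L)]
  refine Nat.add_le_add_left ?_ _
  calc (S.filter (fun t => ¬ t < L)).card ≤ (Ico L n).card := by
        refine Finset.card_le_card fun t ht => ?_
        rw [Finset.mem_filter] at ht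
        rw [Finset.mem_Ico]
        exact ⟨not_lt.mp ht.2, hS t ht.1⟩
    _ = n - L := Nat.card_Ico _ _

/-- The two digit sets `T ∈ {S, S ∪ {n}}` contain `S` and lie in `[0, n]`. [folklore] -/
theorem digitSet_basic {n : ℕ} (A : Finset (Fin n)) {T : Finset ℕ}
    (hT : T = A.map Fin.valEmbedding ∨ T = insert n (A.map Fin.valEmbedding)) :
    A.map Fin.valEmbedding ⊆ T ∧ (∀ t ∈ T, t ≤ n) := by
  have hS : ∀ t ∈ A.map Fin.valEmbedding, t < n := by
    intro t ht
    rw [Finset.mem_map] at ht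
    obtain ⟨x, -, rfl⟩ := ht
    exact x.isLt
  rcases hT with rfl | rfl
  · exact ⟨subset_rfl, fun t ht => (hS t ht).le⟩
  · refine ⟨Finset.subset_insert _ _, fun t ht => ?_⟩
    rw [Finset.mem_insert] at ht
    rcases ht with rfl | ht
    · exact le_rfl
    · exact (hS t ht).le

/-- **Enough digits survive the cut.** If `|A| ≥ s/q + 1`, `T ⊇ A.map val` and the box is large
(`n ≤ i + j + 3q`), then the cut digit set `T ∩ [0, i+j+2)` has at least `M₀ = s/q - 1 - 3q`
elements. [folklore] -/
theorem M₀_le_card_cut {n i j q s : ℕ} (A : Finset (Fin n)) {T : Finset ℕ}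
    (hT : T = A.map Fin.valEmbedding ∨ T = insert n (A.map Fin.valEmbedding))
    (hlarge : n ≤ i + j + 3 * q) (hq : 1 ≤ q) (hA : s / q + 1 ≤ A.card) :
    (s : ℝ) / q - 1 - 3 * q ≤ ((T.filter (· < i + j + 2)).card : ℝ) := by
  classical
  obtain ⟨hST, -⟩ := digitSet_basic A hT
  set S := A.map Fin.valEmbedding with hSdef
  have hSn : ∀ t ∈ S, t < n := by
    intro t ht
    rw [hSdef, Finset.mem_map] at ht
    obtain ⟨x, -, rfl⟩ := ht
    exact x.isLt
  have h1 : S.card ≤ (S.filter (· < i + j + 2)).card + (n - (i + j + 2)) := card_le_card_filter_lt_add S hSn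
  have h2 : (S.filter (· < i + j + 2)).card ≤ (T.filter (· < i + j + 2)).card :=
    Finset.card_le_card (Finset.filter_subset_filter _ hST)
  have h3 : S.card = A.card := Finset.card_map _
  have h4 : n - (i + j + 2) ≤ 3 * q := by omega
  have h5 : s / q + 1 ≤ (T.filter (· < i + j + 2)).card + 3 * q := by omega
  have h5' : ((s / q : ℕ) : ℝ) + 1 ≤ ((T.filter (· < i + j + 2)).card : ℝ) + 3 * q := by exact_mod_cast h5
  have hq0 : (0 : ℝ) < q := by exact_mod_cast hq
  have h6 : (s : ℝ) / q < (s / q : ℕ) + 1 := by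
    have h := Nat.lt_div_mul_add (a := s) (b := q) (by omega)
    have h' : (s : ℝ) < ((s / q : ℕ) : ℝ) * q + q := by exact_mod_cast h
    rw [div_lt_iff₀ hq0]; linarith
  linarith

/-! ### The final numerical step -/

/-- **From the criterion's bound to `2^{n - n^{1/10}}`.** [folklore] -/
theorem final_numeric {n q : ℕ} (hq : 1 ≤ q) (h3q : 3 * q ≤ n) (hE2 : n / 8 + 1 + q ≤ n)
    (hE1 : 8 * ((n : ℝ) + 1) ^ 4 * (2 : ℝ) ^ ((n : ℝ) ^ ((1 : ℝ) / 10)) < (2 : ℝ) ^ q) {W : ℝ}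
    (hW : W ≤ 2 * ((2 ^ (n / 8) : ℕ) : ℝ) +
      (n : ℝ) ^ 2 * (2 ^ n * (2 : ℝ) ^ (-(2 * (q : ℝ))) + 2 ^ (n - 3 * q) * (n + 1)) +
      ((2 ^ q : ℕ) : ℝ) * ((n : ℝ) ^ 2 * (2 ^ n * (2 : ℝ) ^ (-(5 * (q : ℝ))) + 2 ^ (n - 3 * q))) +
      2 ^ n * ((n : ℝ) + 1) ^ 4 / ((2 ^ q : ℕ) : ℝ)) :
    W < (2 : ℝ) ^ ((n : ℝ) - (n : ℝ) ^ ((1 : ℝ) / 10)) := by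
  have h2 : (0 : ℝ) < 2 := by norm_num
  set t : ℝ := (2 : ℝ) ^ q with ht
  set N : ℝ := (2 : ℝ) ^ n with hN
  set y : ℝ := (n : ℝ) ^ ((1 : ℝ) / 10) with hy
  have ht2 : 2 ≤ t := by
    calc (2 : ℝ) = 2 ^ 1 := by norm_num
      _ ≤ 2 ^ q := pow_le_pow_right₀ one_le_two hq
  have ht0 : 0 < t := by positivity
  have hN0 : 0 < N := by positivity
  have hn0 : (0 : ℝ) ≤ n := Nat.cast_nonneg n
  push_cast at hW
  -- the rpow savings in terms of `t`
  have hr2 : (2 : ℝ) ^ (-(2 * (q : ℝ))) = 1 / t ^ 2 := by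
    rw [Real.rpow_neg h2.le, ht, ← Real.rpow_natCast, ← Real.rpow_natCast, ← Real.rpow_mul h2.le,
      one_div]
    push_cast; ring_nf
  have hr5 : (2 : ℝ) ^ (-(5 * (q : ℝ))) = 1 / t ^ 5 := by
    rw [Real.rpow_neg h2.le, ht, ← Real.rpow_natCast, ← Real.rpow_natCast, ← Real.rpow_mul h2.le,
      one_div]
    push_cast; ring_nf
  have hr3 : (2 : ℝ) ^ (n - 3 * q) = N / t ^ 3 := by
    rw [hN, ht, ← pow_mul, pow_sub₀ _ (by norm_num) (by omega)]
    ring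
  have hu : 2 * (2 : ℝ) ^ (n / 8) ≤ N / t := by
    rw [le_div_iff₀ ht0, hN, ht, ← pow_succ', ← pow_add]
    exact pow_le_pow_right₀ one_le_two (by omega)
  rw [hr2, hr5, hr3] at hW
  -- every term is `≤ (n+1)^4 N / t`
  have hn1 : (1 : ℝ) ≤ (n : ℝ) + 1 := by linarith
  have hP4 : (1 : ℝ) ≤ ((n : ℝ) + 1) ^ 4 := one_le_pow₀ hn1
  have hn2 : (n : ℝ) ^ 2 ≤ ((n : ℝ) + 1) ^ 4 := by
    calc (n : ℝ) ^ 2 ≤ ((n : ℝ) + 1) ^ 2 := by gcongr; linarith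
      _ ≤ ((n : ℝ) + 1) ^ 4 := pow_le_pow_right₀ hn1 (by norm_num)
  have hn3 : (n : ℝ) ^ 2 * (n + 1) ≤ ((n : ℝ) + 1) ^ 4 := by
    calc (n : ℝ) ^ 2 * (n + 1) ≤ ((n : ℝ) + 1) ^ 2 * (n + 1) := by gcongr; linarith
      _ = ((n : ℝ) + 1) ^ 3 := by ring
      _ ≤ ((n : ℝ) + 1) ^ 4 := pow_le_pow_right₀ hn1 (by norm_num)
  have hinv : ∀ k : ℕ, 1 ≤ k → N / t ^ k ≤ N / t := by
    intro k hk
    apply div_le_div_of_nonneg_left hN0.le ht0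
    calc t = t ^ 1 := (pow_one t).symm
      _ ≤ t ^ k := pow_le_pow_right₀ (by linarith) hk
  have hb : (n : ℝ) ^ 2 * (N * (1 / t ^ 2) + N / t ^ 3 * (n + 1)) ≤ 2 * (((n : ℝ) + 1) ^ 4 * (N / t)) := by
    have e1 : (n : ℝ) ^ 2 * (N * (1 / t ^ 2) + N / t ^ 3 * (n + 1)) =
        (n : ℝ) ^ 2 * (N / t ^ 2) + (n : ℝ) ^ 2 * (n + 1) * (N / t ^ 3) := by ring
    rw [e1]
    have := hinv 2 (by norm_num)
    have := hinv 3 (by norm_num)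
    nlinarith [mul_le_mul hn2 (hinv 2 (by norm_num)) (by positivity) (by positivity),
      mul_le_mul hn3 (hinv 3 (by norm_num)) (by positivity) (by positivity)]
  have hd : t * ((n : ℝ) ^ 2 * (N * (1 / t ^ 5) + N / t ^ 3)) ≤ 2 * (((n : ℝ) + 1) ^ 4 * (N / t)) := by
    have e1 : t * ((n : ℝ) ^ 2 * (N * (1 / t ^ 5) + N / t ^ 3)) =
        (n : ℝ) ^ 2 * (N / t ^ 4) + (n : ℝ) ^ 2 * (N / t ^ 2) := by
      field_simp
    rw [e1]
    nlinarith [mul_le_mul hn2 (hinv 4 (by norm_num)) (by positivity) (by positivity),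
      mul_le_mul hn2 (hinv 2 (by norm_num)) (by positivity) (by positivity)]
  have hf : N * ((n : ℝ) + 1) ^ 4 / t = ((n : ℝ) + 1) ^ 4 * (N / t) := by ring
  have hall : W ≤ 6 * (((n : ℝ) + 1) ^ 4 * (N / t)) := by
    have ha : 2 * (2 : ℝ) ^ (n / 8) ≤ ((n : ℝ) + 1) ^ 4 * (N / t) := by
      have := mul_le_mul_of_nonneg_right hP4 (show 0 ≤ N / t by positivity)
      linarith
    linarith [hW, ha, hb, hd, hf.le, hf.ge]
  -- and `8 (n+1)^4 N / t < 2^{n - y}`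
  have hfin : 8 * (((n : ℝ) + 1) ^ 4 * (N / t)) < (2 : ℝ) ^ ((n : ℝ) - y) := by
    rw [Real.rpow_sub h2, Real.rpow_natCast, ← hN]
    rw [lt_div_iff₀ (by positivity)]
    calc 8 * (((n : ℝ) + 1) ^ 4 * (N / t)) * (2 : ℝ) ^ y = (8 * ((n : ℝ) + 1) ^ 4 * (2 : ℝ) ^ y) * N / t := by
          ring
      _ < t * N / t := by gcongr
      _ = N := by field_simp
  have hpos : 0 ≤ ((n : ℝ) + 1) ^ 4 * (N / t) := by positivity
  linarith

/-! ### The main theorem: Bourgain's Theorem 1 for `μ` from a type-II box bound -/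

set_option maxHeartbeats 1600000 in
-- the assembly: many cases, one shared context
/-- **Bourgain 2013, Theorem 1 for `μ`, conditionally on the type-II box bound.** If the dyadic box
sums of Walsh characters obey the type-II estimate of Bourgain's §2 in the form displayed as the
hypothesis — for the short side `M = 2^i ≤ N = 2^j`, digit set `T ⊆ [0, i+j+2)`, `1`-bounded
coefficients, guard `1 ≤ g₀ ≤ ρ`, an admissible window `[K, K+i+ρ+g₀+1)`, and constants `c > 0`,
`C ≥ 0`: `|boxSum| ≤ 2^{i+j}(i+j+2)^C (2^{-c g₀} + 2^{Cρ - ci} + 2^{Cρ - c|T ∩ window|})`, i.e. the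
paper's (2.29) `X(L^{-cε} + L²M^{-c} + L^C 2^{-c|S'|})` — then
`max_A |∑_{x<2ⁿ} μ(x) w_A(x)| < 2^{n - n^{1/10}}` for all large `n`, i.e. the named fact
`bourgain_moebius_walsh_uniform`. Ingredients: Green's Proposition 1 for `|A| ≤ ⌊√n⌋/⌊n^{1/8}⌋`
(tree, proved) and Green's four-term identity for `A = ∅`; the tree's Vaughan reduction with
`u = 2^{⌊n/8⌋}`, `B = 2^q`, `q = ⌊n^{1/8}⌋`; the type-I estimate of `MoebiusWalshTypeIEstimate` in its
two regimes and, for a dense top window, the hypothesis; the hypothesis for the type-II boxes through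
a covering family of `≤ 24` admissible windows. [cite: Bourgain2013MoebiusWalsh, Theorem 1 and §§2–3] -/
theorem bourgain_moebius_walsh_uniform_of_typeII
    (hII : ∃ c : ℝ, 0 < c ∧ ∃ C : ℝ, 0 ≤ C ∧
      ∀ (i j ρ g₀ K : ℕ) (T : Finset ℕ) (α β : ℕ → ℝ),
      i ≤ j → 1 ≤ g₀ → g₀ ≤ ρ → C * ρ ≤ i →
      (∀ t ∈ T, t < i + j + 2) →
      (K = 0 ∨ i ≤ K + ρ) →
      (K + (ρ + g₀ + 1) + 1 ≤ j ∨ (j + 2 ≤ K + (ρ + g₀ + 1) ∧ K + ρ ≤ j)) →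
      (∀ a, |α a| ≤ 1) → (∀ b, |β b| ≤ 1) →
      |boxSum T i j α β| ≤ 2 ^ (i + j) * ((i : ℝ) + j + 2) ^ C *
        ((2 : ℝ) ^ (-(c * g₀)) + (2 : ℝ) ^ (C * ρ - c * i) +
          (2 : ℝ) ^ (C * ρ - c * ((T.filter (fun t => K ≤ t ∧ t < K + i + (ρ + g₀ + 1))).card : ℝ)))) :
    bourgain_moebius_walsh_uniform := by
  classical
  obtain ⟨c, hc, C, hC, hII⟩ := hII
  obtain ⟨cG, hcG, KG, hG⟩ := Literature.Computability.Complexity.green_moebius_fourierWalsh_holds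
  have hev := schedule_eventually hc hC walshSupExponent_pos hcG KG
  obtain ⟨n₀, hn₀⟩ := Filter.eventually_atTop.1 hev
  refine ⟨n₀, fun n hn A => ?_⟩
  obtain ⟨⟨hn16, hq1, hs1⟩, hE1, ⟨hE2, hE4, hE11a, hE13⟩, hE10, hE5, hE5', ⟨hE6, hE6', hE6'', hρge⟩,
    hE7, hE8, hE9, ⟨hE11b, hM₀0⟩⟩ := hn₀ n hn
  set q : ℕ := Nat.sqrt (Nat.sqrt (Nat.sqrt n)) with hqdef
  set s : ℕ := Nat.sqrt n with hsdef
  set ρ : ℕ := ⌈(C + 7) * (q : ℝ) / c⌉₊ with hρdef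
  set M₀ : ℝ := (s : ℝ) / q - 1 - 3 * q with hM₀def
  have hq1r : (1 : ℝ) ≤ q := by exact_mod_cast hq1
  have hρ1 : 1 ≤ ρ := by
    have h : (0 : ℝ) < c * ρ := lt_of_lt_of_le (by positivity) hρge
    have h' : (0 : ℝ) < ρ := pos_of_mul_pos_right h hc.le
    exact_mod_cast h'
  have hE3 : (n : ℝ) + 1 ≤ (2 : ℝ) ^ q := by
    have : ((n : ℝ) + 1) ^ 3 ≥ (n : ℝ) + 1 := le_self_pow₀ (by linarith [(Nat.cast_nonneg n : (0:ℝ) ≤ n)]) (by norm_num)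
    linarith
  -- the three cases on `|A|`
  rcases A.eq_empty_or_nonempty with rfl | hAne
  · -- `A = ∅`
    obtain ⟨m, rfl⟩ : ∃ m, n = m + 2 := ⟨n - 2, by omega⟩
    exact green_empty (hG (m + 2) (by omega)) hcG hE5'
  by_cases hsmall : A.card ≤ s / q
  · -- few digits: Green
    refine green_small (hG n (by omega)) hcG A hAne ?_ hE5
    have h1 : A.card * q ≤ s := (Nat.mul_le_mul_right q hsmall).trans (Nat.div_mul_le_self s q)
    have h2 : ((A.card * q : ℕ) : ℝ) ≤ s := by exact_mod_cast h1
    push_cast at h2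
    refine h2.trans ?_
    rw [hsdef]
    have h3 : ((Nat.sqrt n : ℕ) : ℝ) ^ 2 ≤ n := by exact_mod_cast Nat.sqrt_le' n
    exact Real.le_sqrt_of_sq_le h3
  -- many digits: Vaughan's identity and the boxes
  have hAcard : s / q + 1 ≤ A.card := by omega
  have hB1 : 1 ≤ 2 ^ q := Nat.one_le_two_pow
  have hkey := abs_walshSum_moebius_le_of_boxBounds n (2 ^ (n / 8)) (2 ^ q) (3 * q) hB1 A
    (EI := 2 ^ n * (2 : ℝ) ^ (-(2 * (q : ℝ)))) (EII := 2 ^ n * (2 : ℝ) ^ (-(5 * (q : ℝ))))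
    (by positivity) (by positivity) ?_ ?_
  · exact final_numeric hq1 hE4 hE2 hE1 hkey
  · -- TYPE I boxes
    intro T hT i j hijn hlarge
    by_cases hi : i ≤ 2 * (n / 8)
    · have hij : i ≤ j := by omega
      have h2i : 2 * i ≤ j := by omega
      rw [boxSum_eq_boxSum_filter T (le_refl (i + j + 2))]
      set T' := T.filter (· < i + j + 2) with hT'def
      have hT' : ∀ t ∈ T', t < i + j + 2 := fun t ht => (Finset.mem_filter.mp ht).2
      have hM₀T : M₀ ≤ T'.card := M₀_le_card_cut A hT hlarge hq1 hAcard
      have hbox := typeI_box hC hII T' hT' hij h2i hijn hq1 hE3 hE10 hρ1 hM₀T hE9 hE11b hE6'' hρge hE8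
        (2 ^ (n / 8))
      refine hbox.trans ?_
      exact mul_le_mul_of_nonneg_right (pow_le_pow_right₀ one_le_two (by omega)) (by positivity)
    · -- `a > u²`: the coefficient vanishes on the block
      have hzero : boxSum T i j (typeICoeff (2 ^ (n / 8))) (fun _ => 1) = 0 := by
        unfold boxSum
        refine Finset.sum_eq_zero fun a ha => Finset.sum_eq_zero fun b _ => ?_
        rw [mem_dyBlock] at ha
        have hu : 2 ^ (n / 8) * 2 ^ (n / 8) < a := by
          rw [← pow_add]
          exact lt_of_lt_of_le (Nat.pow_lt_pow_right (by norm_num) (by omega)) ha.1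
        rw [MoebiusWalshVaughan.typeICoeff_eq_zero hu]; ring
      rw [hzero, abs_zero]; positivity
  · -- TYPE II boxes
    intro T hT i j hijn hlarge
    have hαb : ∀ a, |typeIICoeffA (2 ^ (n / 8)) (2 ^ q) a| ≤ 1 :=
      fun a => MoebiusWalshVaughan.abs_typeIICoeffA_le hB1 _ a
    have hβb : ∀ b, |typeIICoeffB (2 ^ (n / 8)) b| ≤ 1 := MoebiusWalshVaughan.abs_typeIICoeffB_le _
    by_cases hi : n / 8 ≤ i
    · by_cases hj : n / 8 ≤ j
      · rw [boxSum_eq_boxSum_filter T (le_refl (i + j + 2))]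
        set T' := T.filter (· < i + j + 2) with hT'def
        have hT' : ∀ t ∈ T', t < i + j + 2 := fun t ht => (Finset.mem_filter.mp ht).2
        have hM₀T : M₀ ≤ T'.card := M₀_le_card_cut A hT hlarge hq1 hAcard
        have h3 : C * ρ + (C + 7) * q ≤ c * ((T'.card : ℝ) / 24) :=
          hE7.trans (mul_le_mul_of_nonneg_left (by linarith) hc.le)
        have h2n : (2 : ℝ) ^ (i + j) ≤ 2 ^ n := pow_le_pow_right₀ one_le_two (by omega)
        rcases le_total i j with hij | hji
        · have hbox := typeII_box hC hII T' hT' hij hi hijn hn16 hq1 hE3 hρ1 hE13 hE6' hρge hE6 h3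
            _ _ hαb hβb
          exact hbox.trans (mul_le_mul_of_nonneg_right h2n (by positivity))
        · rw [boxSum_comm]
          have hT'' : ∀ t ∈ T', t < j + i + 2 := fun t ht => by have := hT' t ht; omega
          have h3' : C * ρ + (C + 7) * q ≤ c * ((T'.card : ℝ) / 24) := h3
          have hbox := typeII_box hC hII T' hT'' hji hj (by omega) hn16 hq1 hE3 hρ1 hE13 hE6' hρge hE6 h3'
            _ _ hβb hαb
          refine hbox.trans ?_
          rw [add_comm j i]
          exact mul_le_mul_of_nonneg_right h2n (by positivity)
      · -- `b ≤ u`: `β = μ - μ_u` vanishes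
        have hzero : boxSum T i j (typeIICoeffA (2 ^ (n / 8)) (2 ^ q)) (typeIICoeffB (2 ^ (n / 8))) = 0 := by
          unfold boxSum
          refine Finset.sum_eq_zero fun a _ => Finset.sum_eq_zero fun b hb => ?_
          rw [mem_dyBlock] at hb
          have hbu : b ≤ 2 ^ (n / 8) :=
            (le_of_lt hb.2).trans (Nat.pow_le_pow_right (by norm_num) (by omega))
          rw [MoebiusWalshVaughan.typeIICoeffB_eq_zero hbu]; ring
        rw [hzero, abs_zero]; positivity
    · -- `a ≤ u`: `α` vanishes
      have hzero : boxSum T i j (typeIICoeffA (2 ^ (n / 8)) (2 ^ q)) (typeIICoeffB (2 ^ (n / 8))) = 0 := by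
        unfold boxSum
        refine Finset.sum_eq_zero fun a ha => Finset.sum_eq_zero fun b _ => ?_
        rw [mem_dyBlock] at ha
        have hau : a ≤ 2 ^ (n / 8) :=
          (le_of_lt ha.2).trans (Nat.pow_le_pow_right (by norm_num) (by omega))
        rw [MoebiusWalshVaughan.typeIICoeffA_eq_zero (2 ^ q) hau]; ring
      rw [hzero, abs_zero]; positivity

end Literature.NumberTheory.LFunctions.MoebiusWalsh
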